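import Literature.MathematicalPhysics.QuantumFieldTheory.BalabanImbrieJaffe1984to88.BIJ88Close231WholeTorusFlat
import Literature.MathematicalPhysics.QuantumFieldTheory.BalabanImbrieJaffe1984to88.BIJ88LocDeriv231FlatTorus

/-!
# `BalabanImbrieJaffe1984to88.BIJ88Close231WholeTorusFlatCwt` — T. Bałaban, J. Imbrie, A. Jaffe, *Effective action and cluster properties of
the abelian Higgs model*, Commun. Math. Phys. **114** (1988) 257–315 [BalabanImbrieJaffe1988], §2 (2.31)/(2.35) p. 263 [PDF 7] and the sentence
after (2.33) **WITH THE REGION `Ω = T_η` (THE WHOLE TORUS) AT EVERY FLAT / PURE-GAUGE BACKGROUND `u = 1^h`, FOR THE PRINTED LOCALIZATION DATA OF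
RECORD** (the torus cubes `{□_α}`, the weights `λ_α` of (2.27) and the cut-off `ζ″` of (2.29) of p29 gen 26's `BIJ88LocWeights227Torus`, built
inside a reference no-wrap box `Ω₀`): (2.31) in kernel and operator form, (2.35), and the COVARIANT-DERIVATIVE analogue of (2.31), all against the
WHOLE-TORUS Neumann propagator `G_k(T_η,1^h)` / region form `Δ_k(T_η,1^h)`, hypothesis-free apart from the geometric parameters — r18 gen 22's
abstract-data `Ω = T_η` members (`BIJ88Close231WholeTorusFlat`) and p29 gen 27's `deriv231_flat_cwt` proof, with the one new geometric input:
**row hypothesis (ii) read against the whole torus** holds for the data at chart depth `≥ R₀ + R` (`rowHyp_ii_torus`).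

statement-level skeleton of published theorems with citation tags; proofs where landed; nothing here is a claim about the Yang–Mills mass gap

PDF held: `paper:balaban1988-cmp114-bij-abelian-higgs-effective-action` (journal page = PDF page + 256; p. 263 = PDF 7; text layer re-materialised this
session, `lit read … --pages 7-8`: p0007 L18–26).

CITATION HEADER (lean-in-tree rule).  lit-balaban cell (HOME `run/shared/lean/pub/lit-balaban/`), Phase 2, seat r18 gen 23 (unit `lit-balaban-r18`,
literature-prover-lit-balaban-r18-g23-0; C2 §§1–4 fold owner), free-target protocol G.5-34(d), TAKING line HOME/STATUS.md 2026-08-22T23:13Z (stem check: no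
`…WholeTorusFlatCwt…` stem; the own gen-22 file's HONEST SCOPE (ii)/(v) name exactly these two items as not done; notices to p29 / p31 / r01).  Rows of
`HOME/lit-balaban-r18/ROWS-C2.md` served (LOCATED MEMBERS, cells only; heads unchanged): **C2.Eq2.31** (head p08's hence-step), **C2.Eq2.35** (head
p02's `BIJ88Close235Proof`), **C2.Claim@263** (*"… hold for covariant derivatives …"*, head p08's `BIJ88HolderDecay230`).  Files USED BY NAME, nothing
restated: r18 g22 `BIJ88Close231WholeTorusFlat` (`close231_wholeTorus_flat_kernel_level`, `opClose231_wholeTorus_flat_level`,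
`close235_wholeTorus_flat_level`), r01 g24 `B4Delta112ZeroTorusCube` (`close112_flat_torus`, `close112_flat_torus_deriv`; p341890 / p342535), r18 g19
`BIJ88NeumannPropagatorFlatDecayLevel.decay110_flat_level`, p29 gen 26/27 `BIJ88LocWeights227Torus` (`cubeFam`/`lamFam`/`labels`/`cubeOf`/`lamT`,
`rowHyp_i/ii/iii`, `cubeFam_fits`, `mem_and_abs_sub_le_of_T_le`, `mem_and_depth_of_mem_blockK`, `activeLabels` + `card_subtype_activeLabels_le`,
`mem_activeLabels_of_ne_zero_of_deep`, `sum_abs_lamT_le_one`, `cutoff_eq_zero_of_le`, `cutoff_mem_unitInterval`), `BIJ88LocDeriv230FlatTorus`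
(`exists_abs_cutoff_sub_le`, `T_shift_le_one`, `abs_T_shift_sub_le`, `norm_rowSource_sub_le`), `BIJ88LocDeriv231FlatTorus` (`covD_gLocT_sub_apply`,
`norm_tail_le`, `norm_tailDiff_le`, `T_gt_of_tail_ne_zero`, `T_gt_of_tailDiff_ne_zero`), p31's `BIJ88NeumannPropagatorFlatClose231` (`norm_rowSource_le`,
`rowSource_ne_zero`, `abs_lam_le_one`), `BIJ88NeumannPropagatorFlatDecayCube` (`cubeT`, `boxCoord`, `mem_cubeT_iff_val`), gen 15's `BIJ88DeltaLoc234Torus`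
(`gLocT`, `deltaLocT`, `deltaRegion`), `BIJ88NeumannPropagator227Torus.gBox`, p13's `BIJ88Cutoffs21.cutoff`, p38's `B5Ineq137Torus.T`.

## The print (verbatim, p. 263; v1.1: the lead-in sentence now as printed — ref-5 D-g60-1)

*"The boundary conditions are always at a distance O(r(e_k)) from x₁, x₂, so a straightforward application of the random walk expansion of
[6] shows that |(G_{k,loc}(u)f)(x)| ≦ ce^{−c dist(suppt f,x)}‖f‖_∞, (2.30) |(G_{k,loc}(u)f − G_k(Ω,u)f)(x)| ≦ e^{−cr(e_k)}e^{−c dist(suppt f,x)}‖f‖_∞,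
(2.31) for dist(x,Ω^c) ≧ O(r(e_k)). [Each G_k(□_α,u) is close to G_k(Ω,u) for the relevant x₁, x₂, therefore the convex combination and
G_{k,loc} are close also.] We assume that u is smooth in the □_α's entering the sum in (2.27); for (2.31) we assume smoothness throughout the
subset Ω ⊂ T_η. This means that in a neighborhood of each □_α there exists an A, λ such that u = exp[ie_kη(A + ∂λ)] with |∂A|, |∂*A| ≦ O(p(e_k)).
(2.32) … Bounds analogous to (2.30), (2.31) hold for covariant derivatives and Hölder derivatives of G_{k,loc}(u) of order less than two."*;
*"Hence |Δ_{k,loc}(u;x₁,x₂) − Δ_k(Ω,u;x₁,x₂)| ≦ e^{−cr(e_k)}e^{−c|x₁−x₂|} for dist({x₁,x₂},Ω^c) > O(r(e_k)), (2.35)"*.  (v1 of this header opened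
the first quotation with the words *"Furthermore, we have for u of the form (2.32) that"* — a paraphrase inherited from the gen-22 file, not
print; corrected here, nothing else changed.)  Here `Ω = T_η` (flat `u = 1^h` is
smooth everywhere, `Ω^c = ∅`); the data of record live in a reference box `Ω₀ ⊂ T_η`, and *"for the relevant x"* becomes: `x` at chart depth
`≥ R₀ + R` in `Ω₀`, so that every cube active on the row of `x` keeps the torus margin `R` also towards `T_η ∖ Ω₀`.

## What is proved (theorems only; 0 definitions — the instance torus of §4 is an inline structure literal; 0 `sorry`; no `Prop`-valued fact; standard axioms)

* §1 (private `depth_mono`), `lt_T_of_not_mem` (a point outside `Ω₀` is at sup-torus distance `> D` from every point of chart depth `≥ D` — contrapositive of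
  gen 26's `mem_and_abs_sub_le_of_T_le`), **`rowHyp_ii_torus`**: at chart depth `≥ R₀ + R` an active pair `(x,y)` of the data has `x, y ∈ □_α` and
  EVERY `w ∈ T_η ∖ □_α` at sup-torus distance `≥ R` from both (inside `Ω₀`: gen 26's `rowHyp_ii`; outside `Ω₀`: `x` and `y` have chart depth `≥ R`).
* §2 **`close231_wholeTorus_flat_kernel_cwt`** / **`opClose231_wholeTorus_flat_cwt`** / **`close235_wholeTorus_flat_cwt`** — r18 g22's three
  `Ω = T_η` members INSTANTIATED for the data: ∃ `δ₀, c₀ > 0` from `(d, L, a)` ∀ torus (`P.d = d+1`, `P.L = L`) ∀ `1 ≤ k ≤ K` ∀ reference box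
  `Ω₀ = c·L^k + Π_i[0, L^kM₀_i)` (fit, shorter than the torus, gap `≥ R`) ∀ `s ≥ 1`, `W ≥ 2s/3 + R₀/2 + R`, `0 ≤ R`, `0 ≤ R₁ < R₀` ∀ `h`:
  (kernel) ∀ `x ∈ Ω₀` at chart depth `≥ R₀ + R` ∀ `y`,
  `‖G_{k,loc}(1^h;x,y) − G_k(T_η,1^h;x,y)‖ ≤ (L^kε)²c₀(e^{−2δ₀R/L^k} + e^{−(δ₀/2)R₁/L^k})e^{−(δ₀/2)|x−y|_T/L^k}`;
  (operator) `‖(G_{k,loc}(1^h)f − G_k(T_η,1^h)f)(x)‖ ≤ (L^kε)²c₀(m·e^{−2δ₀R/L^k} + e^{−(δ₀/2)R₁/L^k})e^{−(δ₀/2)D/L^k}F`;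
  ((2.35)) ∀ `y₁` whose `k`-block lies in `Ω₀` with chart margin `R₀ + R` ∀ `y₂`, `‖Δ_{k,loc}(1^h;y₁,y₂) − Δ_k(T_η,1^h;y₁,y₂)‖ ≤
  A·a_kc₀(m·e^{−2δ₀R/L^k} + e^{−(δ₀/2)R₁/L^k})e^{−(δ₀/2)|y₁−y₂|_{T^{(k)}}}`, `m = (⌊(L^k−1+R₀)/s⌋+3)^{d+1}`, `A = α_kL^{kd}`.
* §3 **`deriv231_wholeTorus_flat_cwt`** — THE COVARIANT-DERIVATIVE ANALOGUE OF (2.31) WITH `Ω = T_η`: same data ∀ `1 < R` ∀ bond `⟨x, x+e_μ⟩` with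
  both endpoints in `Ω₀` at chart depth `≥ R₀ + R` ∀ `f`, `‖f‖_∞ ≤ F`, supported at sup-torus distance `≥ D ≥ 0` from `x`:
  `‖D^ε_{1^h}(G_{k,loc}(1^h)f)(b) − D^ε_{1^h}(G_k(T_η,1^h)f)(b)‖ ≤`
  `(L^kε)·c₀·[m(1 + L^k((R₀−R₁)⁻¹ + s⁻¹))e^{−δ₀(2R−1)/L^k} + (1 + L^k(R₀−R₁)⁻¹)e^{−(δ₀/2)(R₁−1)/L^k}]·e^{−(δ₀/2)D/L^k}·F`
  — p29's four-term bond identity and tails VERBATIM, with r01's `□ ⊂ T_η` closeness members (derivative / value) and r18's whole-torus (1.10)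
  members (derivative / value) as the four inputs.
* §4 non-vacuity: `close235_wholeTorus_flat_cwt_instance`, `deriv231_wholeTorus_flat_cwt_instance` — every hypothesis met at once on the `Setup`
  torus `ℤ/162` (`d = 1`, `L = 3`, `k = 1`, `Ω₀ = [0,24)`, `s = 1`) WITH POSITIVE torus margins `R = 1` resp. `R = 2`.
At the printed radii `R, R₁ = r(e_k)L^k` (`s, R₀ − R₁ ~ r(e_{k−1})L^k/L`) every bracket is the print's `e^{−cr(e_k)}` at every level `k`.

HONEST SCOPE / DIVERGENCE.  (i) FLAT / PURE-GAUGE `u = 1^h` ONLY (as every member of the flat lane; the (2.32)-smooth non-flat `u` is p31's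
non-flat chain).  (ii) THE DATA ARE p29's data of record INSIDE A REFERENCE BOX `Ω₀` (cubes clipped to `Ω₀`); print's family covers `T_η` —
a periodic whole-torus cube family is not constructed here; instead the comparison with `G_k(T_η,1^h)` is made at the rows deep inside `Ω₀`
(depth `R₀ + R` instead of gen 26/27's `R₀`: the extra `R` keeps the clipped cubes' torus margin towards `T_η ∖ Ω₀`).  (iii) `d + 1 ≥ 1` directions,
`L` odd `> 1` (r01's / r18's torus-side conventions; p29's `Ω = Ω₀` members are stated for `L = ℓ + 1`).  (iv) Constants: `δ₀ = min`, `c₀ = max`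
of the inputs' (§3: `C = max(c₁, 2c₂Λ₀ + 1, c₃, c₄Λ₀ + 1)` exactly as p29), not optimized; `K_σ` of the cut-off by compactness.  (v) Hölder
quotients of order `θ ≤ 1` / `1 + θ` against `G_k(T_η)` are NOT here (p29 gen 28's lane for `Ω = Ω₀`).  Imports: r18 g22 `BIJ88Close231WholeTorusFlat`
(→ r01 `B4Delta112ZeroTorusCube`, r18 `BIJ88NeumannPropagatorFlatDecayLevel`), p29 `BIJ88LocDeriv231FlatTorus` (→ `BIJ88LocDeriv230FlatTorus` →
`BIJ88LocWeights227Torus`).  Literature + Mathlib only.  Unit `lit-balaban-r18` (literature-prover-lit-balaban-r18-g23-0), 2026-08-22.  v1.1 =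
v1 (p344568) with this module docstring corrected; every declaration and every other docstring byte-identical.  NOT summit progress.
-/

open scoped BigOperators Matrix ComplexConjugate
open Finset Matrix

namespace Literature.MathematicalPhysics.QuantumFieldTheory.BalabanImbrieJaffe1984to88.BIJ88Close231WholeTorusFlatCwt

open Literature.MathematicalPhysics.QuantumFieldTheory.Balaban1983to89
open BIJ88Sect3Statements (U1 toC cfg covD)
open BIJ85BlockAveragesTorus BIJ85BlockAveragesTorusK
open BIJ88NeumannPropagator227Torus (gBox)
open BIJ88DeltaLoc234Torus (gLocT qMatT deltaLocT deltaRegion)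
open BIJ88NeumannPropagatorFlatDecayCube (cubeT boxCoord mem_cubeT_iff_val)
open BIJ88Cutoffs21 (cutoff cutoff_nonneg cutoff_le_one)
open BIJ88LocWeights227Torus
open BIJ88Close231WholeTorusFlat (close231_wholeTorus_flat_kernel_level opClose231_wholeTorus_flat_level close235_wholeTorus_flat_level)
open GaugeField (gaugeAct)

noncomputable section

variable {d : ℕ} {P : Params}

/-! ## §1 The TORUS-RELATIVE row hypothesis (ii) for the printed data at chart depth `≥ R₀ + R` -/

section RowHypTorus

variable (hPd : P.d = d + 1) {n : ℕ} {c M0 : Fin (d + 1) → ℕ} {s W : ℕ}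

/-- kernel: a deeper chart margin implies a shallower one. [folklore] -/
private theorem depth_mono {D D' : ℝ} (hDD : D ≤ D') {x : Balaban1983to89.Site P 0}
    (hdeep : ∀ i, D' ≤ (boxCoord hPd n c x i : ℝ) ∧ (boxCoord hPd n c x i : ℝ) + D' ≤ (n * M0 i : ℕ) - 1) :
    ∀ i, D ≤ (boxCoord hPd n c x i : ℝ) ∧ (boxCoord hPd n c x i : ℝ) + D ≤ (n * M0 i : ℕ) - 1 :=
  fun i => ⟨hDD.trans (hdeep i).1, by linarith [(hdeep i).2]⟩

/-- **A point outside the no-wrap box `Ω₀` is at sup-torus distance `> D` from every point of `Ω₀` of chart depth `≥ D`** (contrapositive of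
gen 26's `mem_and_abs_sub_le_of_T_le`). [cite: BalabanImbrieJaffe1988, (2.27) p.263, dictionary] -/
theorem lt_T_of_not_mem (hfit : ∀ i, c i * n + n * M0 i ≤ P.sitesPerDir 0) {D : ℝ} {x w : Balaban1983to89.Site P 0}
    (hdeep : ∀ i, D ≤ (boxCoord hPd n c x i : ℝ) ∧ (boxCoord hPd n c x i : ℝ) + D ≤ (n * M0 i : ℕ) - 1)
    (hw : w ∉ (cubeT hPd n c fun i => n * M0 i)) : D < B5Ineq137Torus.T P 0 x w :=
  lt_of_not_ge fun hT => hw (mem_and_abs_sub_le_of_T_le hPd hfit hdeep hT).1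

/-- **Row hypothesis (ii) READ AGAINST THE WHOLE TORUS** (the hypothesis of r18 g22's `Ω = T_η` members
`BIJ88Close231WholeTorusFlat.close231_wholeTorus_flat_kernel_level` &c.) for the torus data of (2.27): at a fine site `x ∈ Ω₀` of chart depth
`≥ R₀ + R`, an active pair (`ζ″(x,y)λ_α(x,y) ≠ 0`) has `x, y ∈ □_α`, and EVERY point of the torus outside `□_α` — inside `Ω₀` (gen 26's `rowHyp_ii`:
half-width `W ≥ 2s/3 + R₀/2 + R`, torus gap `n·M₀_i + R ≤ |T^{(0)}|`) or outside `Ω₀` (the extra depth `R`: `x` and the active `y` lie at chart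
depth `≥ R`, `lt_T_of_not_mem`) — is at sup-torus distance `≥ R` from `x` and from `y`. [cite: BalabanImbrieJaffe1988, (2.27) p.263] -/
theorem rowHyp_ii_torus (hn : 1 ≤ n) (hs : 0 < s) (hfit : ∀ i, c i * n + n * M0 i ≤ P.sitesPerDir 0) {R R₀ : ℝ} (hR : 0 ≤ R)
    (hR₀ : 0 ≤ R₀) (hgap : ∀ i, ((n * M0 i : ℕ) : ℝ) + R ≤ P.sitesPerDir 0) (hW : 2 * (s : ℝ) / 3 + R₀ / 2 + R ≤ W)
    {ζ'' : Balaban1983to89.Site P 0 → Balaban1983to89.Site P 0 → ℝ} (hζ : ∀ x y, R₀ ≤ B5Ineq137Torus.T P 0 x y → ζ'' x y = 0)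
    {x : Balaban1983to89.Site P 0} (hx : x ∈ (cubeT hPd n c fun i => n * M0 i))
    (hdeep : ∀ i, R₀ + R ≤ (boxCoord hPd n c x i : ℝ) ∧ (boxCoord hPd n c x i : ℝ) + (R₀ + R) ≤ (n * M0 i : ℕ) - 1) :
    ∀ (α : ↥(labels n M0 s)) (y : Balaban1983to89.Site P 0), ζ'' x y * lamT hPd n c M0 s α.1 x y ≠ 0 →
      x ∈ cubeOf hPd n c M0 s W α.1 ∧ y ∈ cubeOf hPd n c M0 s W α.1 ∧
        ∀ w, w ∉ cubeOf hPd n c M0 s W α.1 → R ≤ B5Ineq137Torus.T P 0 x w ∧ R ≤ B5Ineq137Torus.T P 0 y w := by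
  intro α y hne
  have hdeep₀ := depth_mono hPd (show R₀ ≤ R₀ + R by linarith) hdeep
  have hdeepR := depth_mono hPd (show R ≤ R₀ + R by linarith) hdeep
  obtain ⟨hxα, hyα, hin⟩ := rowHyp_ii hPd hn hs hfit hR hgap hW hζ hx hdeep₀ α y hne
  refine ⟨hxα, hyα, fun w hw => ?_⟩
  by_cases hwΩ : w ∈ (cubeT hPd n c fun i => n * M0 i)
  · exact hin w hwΩ hw
  · -- `w` outside `Ω₀`: both `x` (depth `≥ R₀ + R ≥ R`) and the active `y` (within `R₀` of `x` in the chart, hence depth `≥ R`) are far from it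
    have hζne : ζ'' x y ≠ 0 := left_ne_zero_of_mul hne
    have hT : B5Ineq137Torus.T P 0 x y ≤ R₀ := le_of_lt (lt_of_not_ge fun h => hζne (hζ x y h))
    have hclose := (mem_and_abs_sub_le_of_T_le hPd hfit hdeep₀ hT).2
    have hdeepy : ∀ i, R ≤ (boxCoord hPd n c y i : ℝ) ∧ (boxCoord hPd n c y i : ℝ) + R ≤ (n * M0 i : ℕ) - 1 := by
      intro i
      have h1 := abs_le.1 (show |(boxCoord hPd n c x i : ℝ) - (boxCoord hPd n c y i : ℝ)| ≤ R₀ by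
        have := hclose i; push_cast at this; exact this)
      constructor <;> linarith [(hdeep i).1, (hdeep i).2, h1.1, h1.2]
    exact ⟨(lt_T_of_not_mem hPd hfit hdeepR hwΩ).le, (lt_T_of_not_mem hPd hfit hdeepy hwΩ).le⟩

end RowHypTorus

/-! ## §2 (2.31) (kernel + operator) and (2.35) WITH `Ω = T_η` AT FLAT BACKGROUNDS, FOR THE PRINTED TORUS DATA -/

section Consequences

/-- **(2.31), KERNEL FORM, `Ω = T_η`, AT FLAT BACKGROUNDS FOR THE PRINTED DATA** (r18 g22's `close231_wholeTorus_flat_kernel_level` with its data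
hypotheses discharged by gen 26's §3 and `rowHyp_ii_torus`): there are `δ₀, c₀ > 0` depending on `(d, L, a)` only such that for every volume of
the series (`P.d = d + 1`, `P.L = L`), every `1 ≤ k ≤ K`, every reference no-wrap box `Ω₀ = c·L^k + Π_i[0, L^k·M₀_i)` shorter than the torus
and leaving a torus gap `≥ R`, every cube spacing `s ≥ 1` and half-width `W ≥ 2s/3 + R₀/2 + R`, radii `0 ≤ R`, `0 ≤ R₁ < R₀`, every pure gauge
`h` and every fine site `x ∈ Ω₀` of chart depth `≥ R₀ + R`:
`‖G_{k,loc}(1^h; x, y) − G_k(T_η, 1^h; x, y)‖ ≤ (L^kε)²·c₀(e^{−2δ₀R/L^k} + e^{−(δ₀/2)R₁/L^k})·e^{−(δ₀/2)|x−y|_T/L^k}` for all `y`, where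
`G_{k,loc}(1^h)` is built from the torus cubes `{□_α}`, the weights `λ_α` of (2.27) and the cut-off `ζ″` of (2.29) of gen 26 inside `Ω₀`, and
`G_k(T_η,1^h) = gBox … univ` is the whole-torus Neumann propagator. [cite: BalabanImbrieJaffe1988, (2.31) p.263] -/
theorem close231_wholeTorus_flat_kernel_cwt (d L : ℕ) (hL : Odd L ∧ 1 < L) {a : ℝ} (ha : 0 < a) :
    ∃ δ₀ c₀ : ℝ, 0 < δ₀ ∧ 0 < c₀ ∧ ∀ (P : Params) (hPd : P.d = d + 1), P.L = L →
      ∀ k : ℕ, 1 ≤ k → k ≤ P.K → ∀ (c M0 : Fin (d + 1) → ℕ), (∀ i, 1 ≤ M0 i) →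
        (∀ i, c i * P.L ^ k + P.L ^ k * M0 i ≤ P.sitesPerDir 0) → (∀ i, P.L ^ k * M0 i < P.sitesPerDir 0) →
      ∀ (s W : ℕ), 1 ≤ s → ∀ (R R₀ R₁ : ℝ), 0 ≤ R → 0 ≤ R₁ → R₁ < R₀ → 2 * (s : ℝ) / 3 + R₀ / 2 + R ≤ W →
        (∀ i, ((P.L ^ k * M0 i : ℕ) : ℝ) + R ≤ P.sitesPerDir 0) →
      ∀ (h : GaugeTransf P 0 U1) (x : Balaban1983to89.Site P 0), x ∈ (cubeT hPd (P.L ^ k) c fun i => P.L ^ k * M0 i) →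
        (∀ i, R₀ + R ≤ (boxCoord hPd (P.L ^ k) c x i : ℝ) ∧ (boxCoord hPd (P.L ^ k) c x i : ℝ) + (R₀ + R) ≤ (P.L ^ k * M0 i : ℕ) - 1) →
      ∀ y : Balaban1983to89.Site P 0,
        ‖gLocT (B1RG242Torus.α P a k * (P.L : ℝ) ^ (k * P.d)) P.eps⁻¹ (gaugeAct h (1 : GaugeField P 0 U1)) k
              (cubeFam hPd (P.L ^ k) c M0 s W) (lamFam hPd (P.L ^ k) c M0 s) (cutoff R₁ R₀ (B5Ineq137Torus.T P 0)) x y -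
            gBox (B1RG242Torus.α P a k * (P.L : ℝ) ^ (k * P.d)) P.eps⁻¹ (gaugeAct h (1 : GaugeField P 0 U1)) k univ x y‖ ≤
          P.spacing k ^ 2 * (c₀ * (Real.exp (-(δ₀ * (((P.L : ℝ) ^ k)⁻¹ * (2 * R)))) + Real.exp (-(δ₀ / 2 * (((P.L : ℝ) ^ k)⁻¹ * R₁)))) *
            Real.exp (-(δ₀ / 2 * (((P.L : ℝ) ^ k)⁻¹ * B5Ineq137Torus.T P 0 x y)))) := by
  obtain ⟨δ₀, c₀, hδ₀, hc₀, H⟩ := close231_wholeTorus_flat_kernel_level d L hL ha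
  refine ⟨δ₀, c₀, hδ₀, hc₀, ?_⟩
  intro P hPd hPL k hk1 hkK c M0 hM0 hfit0 hN0 s W hs R R₀ R₁ hR hR₁ hR10 hW hgap h x hx hdeep y
  have hn : 1 ≤ P.L ^ k := Nat.one_le_pow _ _ P.L_pos
  have hR₀ : 0 ≤ R₀ := hR₁.trans hR10.le
  have hζ0 := cutoff_eq_zero_of_le (P := P) hR10
  have hdeep₀ := depth_mono hPd (show R₀ ≤ R₀ + R by linarith) hdeep
  exact H P hPd hPL k hk1 hkK _ (cubeFam hPd (P.L ^ k) c M0 s W) (lamFam hPd (P.L ^ k) c M0 s)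
    (cutoff R₁ R₀ (B5Ineq137Torus.T P 0)) (cubeFam_fits hM0 hfit0 hN0) (sum_abs_lamT_le_one hfit0) (cutoff_mem_unitInterval R₁ R₀) h x R R₁
    hR hR₁ (rowHyp_i hPd hfit0 hζ0 hx hdeep₀) (rowHyp_ii_torus hPd hn hs hfit0 hR hR₀ hgap hW hζ0 hx hdeep) (rowHyp_iii hR10 x) y

/-- **(2.31), OPERATOR FORM, `Ω = T_η`, AT FLAT BACKGROUNDS FOR THE PRINTED DATA** (r18 g22's `opClose231_wholeTorus_flat_level` with its row
hypotheses discharged by gen 26's §3 / `rowHyp_ii_torus` and the multiplicity `#S` bounded by gen 26's §4): for every volume, `1 ≤ k ≤ K`, every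
reference no-wrap box `Ω₀` leaving a torus gap `≥ R`, cube spacing `s ≥ 1`, half-width `W ≥ 2s/3 + R₀/2 + R`, radii `0 ≤ R`, `0 ≤ R₁ < R₀`, every
pure gauge `h`, every fine row `x ∈ Ω₀` of chart depth `≥ R₀ + R` and every `f` with `‖f‖_∞ ≤ F` supported at sup-torus distance `≥ D ≥ 0` from `x`:
`‖(G_{k,loc}(1^h)f − G_k(T_η,1^h)f)(x)‖ ≤ (L^kε)²·c₀(m·e^{−2δ₀R/L^k} + e^{−(δ₀/2)R₁/L^k})·e^{−(δ₀/2)D/L^k}·F`, `m = (⌊(L^k − 1 + R₀)/s⌋ + 3)^{d+1}`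
— the printed *"|(G_{k,loc}(u)f − G_k(Ω,u)f)(x)| ≦ e^{−cr(e_k)}e^{−c dist(suppt f,x)}‖f‖_∞ (2.31)"* with `Ω = T_η` at `u = 1^h` for the printed
localization (bracket `= e^{−cr(e_k)}` at the printed radii `R, R₁ ~ r(e_k)L^k`). [cite: BalabanImbrieJaffe1988, (2.31) p.263] -/
theorem opClose231_wholeTorus_flat_cwt (d L : ℕ) (hL : Odd L ∧ 1 < L) {a : ℝ} (ha : 0 < a) :
    ∃ δ₀ c₀ : ℝ, 0 < δ₀ ∧ 0 < c₀ ∧ ∀ (P : Params) (hPd : P.d = d + 1), P.L = L →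
      ∀ k : ℕ, 1 ≤ k → k ≤ P.K → ∀ (c M0 : Fin (d + 1) → ℕ), (∀ i, 1 ≤ M0 i) →
        (∀ i, c i * P.L ^ k + P.L ^ k * M0 i ≤ P.sitesPerDir 0) → (∀ i, P.L ^ k * M0 i < P.sitesPerDir 0) →
      ∀ (s W : ℕ), 1 ≤ s → ∀ (R R₀ R₁ : ℝ), 0 ≤ R → 0 ≤ R₁ → R₁ < R₀ → 2 * (s : ℝ) / 3 + R₀ / 2 + R ≤ W →
        (∀ i, ((P.L ^ k * M0 i : ℕ) : ℝ) + R ≤ P.sitesPerDir 0) →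
      ∀ (h : GaugeTransf P 0 U1) (x : Balaban1983to89.Site P 0), x ∈ (cubeT hPd (P.L ^ k) c fun i => P.L ^ k * M0 i) →
        (∀ i, R₀ + R ≤ (boxCoord hPd (P.L ^ k) c x i : ℝ) ∧ (boxCoord hPd (P.L ^ k) c x i : ℝ) + (R₀ + R) ≤ (P.L ^ k * M0 i : ℕ) - 1) →
      ∀ (f : Balaban1983to89.Site P 0 → ℂ) (F D : ℝ), (∀ y, ‖f y‖ ≤ F) → 0 ≤ D → (∀ y, f y ≠ 0 → D ≤ B5Ineq137Torus.T P 0 x y) →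
        ‖(gLocT (B1RG242Torus.α P a k * (P.L : ℝ) ^ (k * P.d)) P.eps⁻¹ (gaugeAct h (1 : GaugeField P 0 U1)) k
              (cubeFam hPd (P.L ^ k) c M0 s W) (lamFam hPd (P.L ^ k) c M0 s) (cutoff R₁ R₀ (B5Ineq137Torus.T P 0)) *ᵥ f) x -
            (gBox (B1RG242Torus.α P a k * (P.L : ℝ) ^ (k * P.d)) P.eps⁻¹ (gaugeAct h (1 : GaugeField P 0 U1)) k univ *ᵥ f) x‖ ≤
          P.spacing k ^ 2 * (c₀ * (((⌊(((P.L : ℝ) ^ k) - 1 + R₀) / s⌋₊ : ℝ) + 3) ^ (d + 1) *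
              Real.exp (-(δ₀ * (((P.L : ℝ) ^ k)⁻¹ * (2 * R)))) + Real.exp (-(δ₀ / 2 * (((P.L : ℝ) ^ k)⁻¹ * R₁)))) *
            Real.exp (-(δ₀ / 2 * (((P.L : ℝ) ^ k)⁻¹ * D))) * F) := by
  obtain ⟨δ₀, c₀, hδ₀, hc₀, H⟩ := opClose231_wholeTorus_flat_level d L hL ha
  refine ⟨δ₀, c₀, hδ₀, hc₀, ?_⟩
  intro P hPd hPL k hk1 hkK c M0 hM0 hfit0 hN0 s W hs R R₀ R₁ hR hR₁ hR10 hW hgap h x hx hdeep f F D hF hD hsupp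
  have hn : 1 ≤ P.L ^ k := Nat.one_le_pow _ _ P.L_pos
  have hk : 0 + k ≤ P.m + P.K := by omega
  have hR₀ : 0 ≤ R₀ := hR₁.trans hR10.le
  have hζ0 := cutoff_eq_zero_of_le (P := P) hR10
  have hF0 : 0 ≤ F := (norm_nonneg _).trans (hF x)
  have hdeep₀ := depth_mono hPd (show R₀ ≤ R₀ + R by linarith) hdeep
  set S : Finset ↥(labels (P.L ^ k) M0 s) := (activeLabels hPd (P.L ^ k) c s R₀ (blkIter k x)).subtype fun α => α ∈ labels (P.L ^ k) M0 s
    with hSdef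
  have hS : ∀ (α : ↥(labels (P.L ^ k) M0 s)) (y : Balaban1983to89.Site P 0),
      cutoff R₁ R₀ (B5Ineq137Torus.T P 0) x y * lamFam hPd (P.L ^ k) c M0 s α x y ≠ 0 → f y ≠ 0 → α ∈ S := by
    intro α y hne _
    rw [hSdef, Finset.mem_subtype]
    exact mem_activeLabels_of_ne_zero_of_deep hk hs hfit0 hζ0 (mem_blockK.2 rfl) hdeep₀ hne
  have hB := H P hPd hPL k hk1 hkK _ (cubeFam hPd (P.L ^ k) c M0 s W) (lamFam hPd (P.L ^ k) c M0 s)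
    (cutoff R₁ R₀ (B5Ineq137Torus.T P 0)) (cubeFam_fits hM0 hfit0 hN0) (sum_abs_lamT_le_one hfit0) (cutoff_mem_unitInterval R₁ R₀) h x R R₁
    hR hR₁ (rowHyp_i hPd hfit0 hζ0 hx hdeep₀) (rowHyp_ii_torus hPd hn hs hfit0 hR hR₀ hgap hW hζ0 hx hdeep) (rowHyp_iii hR10 x) f F D hF hD
    hsupp S hS
  refine hB.trans ?_
  have hcard : (S.card : ℝ) ≤ (⌊(((P.L : ℝ) ^ k) - 1 + R₀) / s⌋₊ + 3) ^ (d + 1) := by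
    have h1 := card_subtype_activeLabels_le (hPd := hPd) (c := c) (M0 := M0) hn hs hR₀ (blkIter k x)
    have e : (((P.L ^ k : ℕ) : ℕ) : ℝ) = (P.L : ℝ) ^ k := by push_cast; rfl
    rw [hSdef]
    rw [e] at h1
    exact h1
  have hE1 := (Real.exp_pos (-(δ₀ * (((P.L : ℝ) ^ k)⁻¹ * (2 * R))))).le
  have hE2 := (Real.exp_pos (-(δ₀ / 2 * (((P.L : ℝ) ^ k)⁻¹ * D)))).le
  refine mul_le_mul_of_nonneg_left ?_ (sq_nonneg _)
  refine mul_le_mul_of_nonneg_right (mul_le_mul_of_nonneg_right (mul_le_mul_of_nonneg_left ?_ hc₀.le) hE2) hF0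
  exact add_le_add (mul_le_mul_of_nonneg_right hcard hE1) le_rfl

/-- **(2.35), `Ω = T_η`, AT FLAT BACKGROUNDS FOR THE PRINTED DATA** (r18 g22's `close235_wholeTorus_flat_level` with its row hypotheses discharged
by gen 26's §3 / `rowHyp_ii_torus` and the multiplicity bounded by gen 26's §4): for every volume, `1 ≤ k ≤ K`, every reference no-wrap box `Ω₀`
leaving a torus gap `≥ R`, cube spacing `s ≥ 1`, half-width `W ≥ 2s/3 + R₀/2 + R`, radii `0 ≤ R`, `0 ≤ R₁ < R₀`, every pure gauge `h`, every
`k`-block site `y₁` whose block lies inside `Ω₀` with chart margin `R₀ + R`, and EVERY `y₂ ∈ T^{(k)}`: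
`‖Δ_{k,loc}(1^h; y₁, y₂) − Δ_k(T_η, 1^h; y₁, y₂)‖ ≤ A·a_k·c₀(m·e^{−2δ₀R/L^k} + e^{−(δ₀/2)R₁/L^k})·e^{−(δ₀/2)|y₁−y₂|_{T^{(k)}}}`,
`m = (⌊(L^k − 1 + R₀)/s⌋ + 3)^{d+1}`, `A = α_kL^{kd}` (gen 15's counting normalization), `Δ_k(T_η,1^h) = deltaRegion A ε⁻¹ (1^h) k univ` — the
printed *"|Δ_{k,loc}(u;x₁,x₂) − Δ_k(Ω,u;x₁,x₂)| ≤ e^{−cr(e_k)}e^{−c|x₁−x₂|} (2.35)"* with `Ω = T_η` at `u = 1^h` for the printed localization.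
[cite: BalabanImbrieJaffe1988, (2.35) p.263] -/
theorem close235_wholeTorus_flat_cwt (d L : ℕ) (hL : Odd L ∧ 1 < L) {a : ℝ} (ha : 0 < a) :
    ∃ δ₀ c₀ : ℝ, 0 < δ₀ ∧ 0 < c₀ ∧ ∀ (P : Params) (hPd : P.d = d + 1), P.L = L →
      ∀ k : ℕ, 1 ≤ k → k ≤ P.K → ∀ (c M0 : Fin (d + 1) → ℕ), (∀ i, 1 ≤ M0 i) →
        (∀ i, c i * P.L ^ k + P.L ^ k * M0 i ≤ P.sitesPerDir 0) → (∀ i, P.L ^ k * M0 i < P.sitesPerDir 0) →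
      ∀ (s W : ℕ), 1 ≤ s → ∀ (R R₀ R₁ : ℝ), 0 ≤ R → 0 ≤ R₁ → R₁ < R₀ → 2 * (s : ℝ) / 3 + R₀ / 2 + R ≤ W →
        (∀ i, ((P.L ^ k * M0 i : ℕ) : ℝ) + R ≤ P.sitesPerDir 0) →
      ∀ (h : GaugeTransf P 0 U1) (y₁ y₂ : Balaban1983to89.Site P (0 + k)),
        (∀ μ, (c (Fin.cast hPd μ) : ℝ) * P.L ^ k + (R₀ + R) ≤ (P.L : ℝ) ^ k * (y₁ μ).val ∧
          (P.L : ℝ) ^ k * (y₁ μ).val + P.L ^ k + (R₀ + R) ≤ (c (Fin.cast hPd μ) : ℝ) * P.L ^ k + (P.L : ℝ) ^ k * M0 (Fin.cast hPd μ)) →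
        ‖deltaLocT (B1RG242Torus.α P a k * (P.L : ℝ) ^ (k * P.d)) P.eps⁻¹ (gaugeAct h (1 : GaugeField P 0 U1)) k
              (cubeFam hPd (P.L ^ k) c M0 s W) (lamFam hPd (P.L ^ k) c M0 s) (cutoff R₁ R₀ (B5Ineq137Torus.T P 0)) y₁ y₂ -
            deltaRegion (B1RG242Torus.α P a k * (P.L : ℝ) ^ (k * P.d)) P.eps⁻¹ (gaugeAct h (1 : GaugeField P 0 U1)) k univ y₁ y₂‖ ≤
          (B1RG242Torus.α P a k * (P.L : ℝ) ^ (k * P.d)) * (B1.aSeq a P.L k * c₀ *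
            ((⌊(((P.L : ℝ) ^ k) - 1 + R₀) / s⌋₊ + 3) ^ (d + 1) * Real.exp (-(δ₀ * (((P.L : ℝ) ^ k)⁻¹ * (2 * R)))) +
              Real.exp (-(δ₀ / 2 * (((P.L : ℝ) ^ k)⁻¹ * R₁)))) *
              Real.exp (-(δ₀ / 2 * (B5Ineq137Torus.T P (0 + k) y₁ y₂)))) := by
  obtain ⟨δ₀, c₀, hδ₀, hc₀, H⟩ := close235_wholeTorus_flat_level d L hL ha
  refine ⟨δ₀, c₀, hδ₀, hc₀, ?_⟩
  intro P hPd hPL k hk1 hkK c M0 hM0 hfit0 hN0 s W hs R R₀ R₁ hR hR₁ hR10 hW hgap h y₁ y₂ hdeepB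
  have hn : 1 ≤ P.L ^ k := Nat.one_le_pow _ _ P.L_pos
  have hk : 0 + k ≤ P.m + P.K := by omega
  have hR₀ : 0 ≤ R₀ := hR₁.trans hR10.le
  have hζ0 := cutoff_eq_zero_of_le (P := P) hR10
  have hxdeep := fun x (hx : x ∈ blockK k y₁) => mem_and_depth_of_mem_blockK hPd hk hfit0 (by linarith : 0 ≤ R₀ + R) hdeepB hx
  have hxdeep₀ := fun x (hx : x ∈ blockK k y₁) => depth_mono hPd (show R₀ ≤ R₀ + R by linarith) (hxdeep x hx).2
  set S : Finset ↥(labels (P.L ^ k) M0 s) := (activeLabels hPd (P.L ^ k) c s R₀ y₁).subtype fun α => α ∈ labels (P.L ^ k) M0 s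
    with hSdef
  have hS : ∀ x ∈ blockK k y₁, ∀ (α : ↥(labels (P.L ^ k) M0 s)) (y : Balaban1983to89.Site P 0),
      cutoff R₁ R₀ (B5Ineq137Torus.T P 0) x y * lamFam hPd (P.L ^ k) c M0 s α x y ≠ 0 → α ∈ S := by
    intro x hx α y hne
    rw [hSdef, Finset.mem_subtype]
    exact mem_activeLabels_of_ne_zero_of_deep hk hs hfit0 hζ0 hx (hxdeep₀ x hx) hne
  have hB := H P hPd hPL k hk1 hkK _ (cubeFam hPd (P.L ^ k) c M0 s W) (lamFam hPd (P.L ^ k) c M0 s)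
    (cutoff R₁ R₀ (B5Ineq137Torus.T P 0)) (cubeFam_fits hM0 hfit0 hN0) (sum_abs_lamT_le_one hfit0) (cutoff_mem_unitInterval R₁ R₀) h R R₁ hR hR₁
    y₁ y₂ (fun x hx => rowHyp_i hPd hfit0 hζ0 (hxdeep x hx).1 (hxdeep₀ x hx))
    (fun x hx => rowHyp_ii_torus hPd hn hs hfit0 hR hR₀ hgap hW hζ0 (hxdeep x hx).1 (hxdeep x hx).2) (fun x _ => rowHyp_iii hR10 x) S hS
  refine hB.trans ?_
  have hak : 0 < B1.aSeq a P.L k := B1.aSeq_pos ha (B1RG242Torus.one_lt_cast_L P) hk1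
  have hα : 0 < B1RG242Torus.α P a k := mul_pos hak (inv_pos.mpr (pow_pos (P.spacing_pos k) 2))
  have hA : 0 < B1RG242Torus.α P a k * (P.L : ℝ) ^ (k * P.d) := mul_pos hα (pow_pos P.cast_L_pos _)
  have hcard : (S.card : ℝ) ≤ (⌊(((P.L : ℝ) ^ k) - 1 + R₀) / s⌋₊ + 3) ^ (d + 1) := by
    have h1 := card_subtype_activeLabels_le (hPd := hPd) (c := c) (M0 := M0) hn hs hR₀ y₁
    have e : (((P.L ^ k : ℕ) : ℕ) : ℝ) = (P.L : ℝ) ^ k := by push_cast; rfl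
    rw [hSdef]
    rw [e] at h1
    exact h1
  have hE1 := (Real.exp_pos (-(δ₀ * (((P.L : ℝ) ^ k)⁻¹ * (2 * R))))).le
  have hE3 := (Real.exp_pos (-(δ₀ / 2 * (B5Ineq137Torus.T P (0 + k) y₁ y₂)))).le
  refine mul_le_mul_of_nonneg_left ?_ hA.le
  refine mul_le_mul_of_nonneg_right ?_ hE3
  refine mul_le_mul_of_nonneg_left ?_ (mul_pos hak hc₀).le
  exact add_le_add (mul_le_mul_of_nonneg_right hcard hE1) le_rfl

end Consequences

/-! ## §3 The COVARIANT-DERIVATIVE analogue of (2.31) WITH `Ω = T_η` at flat backgrounds, for the printed torus data -/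

section Deriv

open BIJ88NeumannPropagatorFlatClose231 (norm_rowSource_le rowSource_ne_zero abs_lam_le_one)
open BIJ88LocDeriv230FlatTorus (exists_abs_cutoff_sub_le T_shift_le_one abs_T_shift_sub_le norm_rowSource_sub_le)
open BIJ88LocDeriv231FlatTorus (covD_gLocT_sub_apply norm_tail_le norm_tailDiff_le T_gt_of_tail_ne_zero T_gt_of_tailDiff_ne_zero)
open BIJ88NeumannPropagatorFlatDecayLevel (decay110_flat_level)
open B4Delta112ZeroTorusCube (close112_flat_torus close112_flat_torus_deriv)

/-- kernel: `e^{−δ'E} ≤ e^{−δE}` for `δ ≤ δ'`, `E ≥ 0`. [folklore] -/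
private theorem exp_le_exp_of_rate {δ δ' E : ℝ} (hδ : δ ≤ δ') (hE : 0 ≤ E) : Real.exp (-(δ' * E)) ≤ Real.exp (-(δ * E)) :=
  Real.exp_le_exp.2 (neg_le_neg (mul_le_mul_of_nonneg_right hδ hE))

/-- **THE COVARIANT-DERIVATIVE ANALOGUE OF (2.31) WITH `Ω = T_η` AT EVERY PURE-GAUGE BACKGROUND `u = 1^h`, FOR THE PRINTED LOCALIZATION DATA**
(p. 263: *"Bounds analogous to (2.30), (2.31) hold for covariant derivatives and Holder derivatives of G_{k,loc}(u) of order less than two"*,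
the (2.31)-analogue for the covariant derivative, with the region `Ω` of (2.31) = the whole torus).  THERE EXIST `δ₀, c₀ > 0` depending on
`(d, L, a)` only such that for every volume of the series (`P.d = d+1`, `P.L = L`), every `1 ≤ k ≤ K`, every reference no-wrap box
`Ω₀ = c·L^k + Π_i[0, L^k·M₀_i)` shorter than the torus and leaving a torus gap `≥ R`, every cube spacing `s ≥ 1` and half-width
`W ≥ 2s/3 + R₀/2 + R`, radii `1 < R`, `0 ≤ R₁ < R₀`, every pure gauge `h`, every bond `b = ⟨x, x + e_μ⟩` of the fine torus with both endpoints
in `Ω₀` at chart depth `≥ R₀ + R`, and every source `f` with `‖f‖_∞ ≤ F` supported at sup-torus distance `≥ D ≥ 0` from `x`: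
`‖D^ε_{1^h}(G_{k,loc}(1^h)f)(b) − D^ε_{1^h}(G_k(T_η,1^h)f)(b)‖ ≤
 (L^kε)·c₀·[m·(1 + L^k((R₀−R₁)⁻¹ + s⁻¹))·e^{−δ₀(2R−1)/L^k} + (1 + L^k(R₀−R₁)⁻¹)·e^{−(δ₀/2)(R₁−1)/L^k}]·e^{−(δ₀/2)D/L^k}·F`,
`m = (⌊(L^k − 1 + R₀)/s⌋ + 3)^{d+1}`, where `G_{k,loc}(1^h)` is built from the torus cubes, the weights of (2.27) and the cut-off of (2.29) of gen 26
inside `Ω₀`, `G_k(T_η,1^h) = gBox … univ` and `D^ε_u φ(b) = ε⁻¹(u(b)φ(b₊) − φ(b₋))` — p29 gen 27's `deriv231_flat_cwt` proof (four-term bond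
identity `covD_gLocT_sub_apply`, tails, multiplicities) with the input swap `close112_flat_cube(_deriv)_level` («`□ ⊂ Ω₀`») ↦ r01 g24's
`close112_flat_torus(_deriv)` («`□ ⊂ T_η`», p341890 / p342535) and `decay110_flat_cube(_deriv)_level` ↦ r18 g19's `decay110_flat_level`
(`G_k(T_η,1^h)`), the torus-relative geometry supplied by `rowHyp_ii_torus`. At the printed radii the bracket is print's `e^{−cr(e_k)}`.
[cite: BalabanImbrieJaffe1988, (2.31) p.263] -/
theorem deriv231_wholeTorus_flat_cwt (d L : ℕ) (hL : Odd L ∧ 1 < L) {a : ℝ} (ha : 0 < a) :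
    ∃ δ₀ c₀ : ℝ, 0 < δ₀ ∧ 0 < c₀ ∧ ∀ (P : Params) (hPd : P.d = d + 1), P.L = L →
      ∀ k : ℕ, 1 ≤ k → k ≤ P.K → ∀ (c M0 : Fin (d + 1) → ℕ), (∀ i, 1 ≤ M0 i) →
        (∀ i, c i * P.L ^ k + P.L ^ k * M0 i ≤ P.sitesPerDir 0) → (∀ i, P.L ^ k * M0 i < P.sitesPerDir 0) →
      ∀ (s W : ℕ), 1 ≤ s → ∀ (R R₀ R₁ : ℝ), 1 < R → 0 ≤ R₁ → R₁ < R₀ → 2 * (s : ℝ) / 3 + R₀ / 2 + R ≤ W →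
        (∀ i, ((P.L ^ k * M0 i : ℕ) : ℝ) + R ≤ P.sitesPerDir 0) →
      ∀ (h : GaugeTransf P 0 U1) (x : Balaban1983to89.Site P 0) (μ : Fin P.d),
        x ∈ (cubeT hPd (P.L ^ k) c fun i => P.L ^ k * M0 i) →
        (∀ i, R₀ + R ≤ (boxCoord hPd (P.L ^ k) c x i : ℝ) ∧ (boxCoord hPd (P.L ^ k) c x i : ℝ) + (R₀ + R) ≤ (P.L ^ k * M0 i : ℕ) - 1) →
        x.shift μ ∈ (cubeT hPd (P.L ^ k) c fun i => P.L ^ k * M0 i) →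
        (∀ i, R₀ + R ≤ (boxCoord hPd (P.L ^ k) c (x.shift μ) i : ℝ) ∧
          (boxCoord hPd (P.L ^ k) c (x.shift μ) i : ℝ) + (R₀ + R) ≤ (P.L ^ k * M0 i : ℕ) - 1) →
      ∀ (f : Balaban1983to89.Site P 0 → ℂ) (F D : ℝ), (∀ y, ‖f y‖ ≤ F) → 0 ≤ D → (∀ y, f y ≠ 0 → D ≤ B5Ineq137Torus.T P 0 x y) →
        ‖covD P.eps⁻¹ (cfg (gaugeAct h (1 : GaugeField P 0 U1)))
              (gLocT (B1RG242Torus.α P a k * (P.L : ℝ) ^ (k * P.d)) P.eps⁻¹ (gaugeAct h (1 : GaugeField P 0 U1)) k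
                (cubeFam hPd (P.L ^ k) c M0 s W) (lamFam hPd (P.L ^ k) c M0 s) (cutoff R₁ R₀ (B5Ineq137Torus.T P 0)) *ᵥ f) ⟨x, μ⟩ -
            covD P.eps⁻¹ (cfg (gaugeAct h (1 : GaugeField P 0 U1)))
              (gBox (B1RG242Torus.α P a k * (P.L : ℝ) ^ (k * P.d)) P.eps⁻¹ (gaugeAct h (1 : GaugeField P 0 U1)) k univ *ᵥ f) ⟨x, μ⟩‖ ≤
          P.spacing k * (c₀ * ((⌊(((P.L : ℝ) ^ k) - 1 + R₀) / s⌋₊ + 3) ^ (d + 1) * (1 + (P.L : ℝ) ^ k * ((R₀ - R₁)⁻¹ + (s : ℝ)⁻¹)) *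
              Real.exp (-(δ₀ * (((P.L : ℝ) ^ k)⁻¹ * (2 * R - 1)))) +
            (1 + (P.L : ℝ) ^ k * (R₀ - R₁)⁻¹) * Real.exp (-(δ₀ / 2 * (((P.L : ℝ) ^ k)⁻¹ * (R₁ - 1))))) *
            Real.exp (-(δ₀ / 2 * (((P.L : ℝ) ^ k)⁻¹ * D))) * F) := by
  obtain ⟨δ₁, c₁, hδ₁, hc₁, H1⟩ := close112_flat_torus_deriv d L hL ha
  obtain ⟨δ₂, c₂, hδ₂, hc₂, H2⟩ := close112_flat_torus d L hL ha
  obtain ⟨δ₃, c₃, hδ₃, hc₃, H3⟩ := decay110_flat_level (d + 1) L (by omega) hL ha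
  obtain ⟨δ₄, c₄, hδ₄, hc₄, H4⟩ := decay110_flat_level (d + 1) L (by omega) hL ha
  obtain ⟨K, hK0, hK⟩ := exists_abs_cutoff_sub_le
  set Λ₀ : ℝ := max K (3 * Real.pi * (d + 1 : ℕ) / 2) with hΛ₀def
  have hΛ₀0 : 0 ≤ Λ₀ := hK0.trans (le_max_left _ _)
  have hΛ₀K : K ≤ Λ₀ := le_max_left _ _
  set δ : ℝ := min (min δ₁ δ₂) (min δ₃ δ₄) with hδdef
  have hδ0 : 0 < δ := lt_min (lt_min hδ₁ hδ₂) (lt_min hδ₃ hδ₄)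
  have hδ1 : δ ≤ δ₁ := (min_le_left _ _).trans (min_le_left _ _)
  have hδ2 : δ ≤ δ₂ := (min_le_left _ _).trans (min_le_right _ _)
  have hδ3 : δ ≤ δ₃ := (min_le_right _ _).trans (min_le_left _ _)
  have hδ4 : δ ≤ δ₄ := (min_le_right _ _).trans (min_le_right _ _)
  set C : ℝ := max (max c₁ (2 * c₂ * Λ₀ + 1)) (max c₃ (c₄ * Λ₀ + 1)) with hCdef
  have hC1 : c₁ ≤ C := (le_max_left _ _).trans (le_max_left _ _)
  have hC2 : 2 * c₂ * Λ₀ + 1 ≤ C := (le_max_right _ _).trans (le_max_left _ _)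
  have hC3 : c₃ ≤ C := (le_max_left _ _).trans (le_max_right _ _)
  have hC4 : c₄ * Λ₀ + 1 ≤ C := (le_max_right _ _).trans (le_max_right _ _)
  have hC0 : 0 ≤ C := hc₁.le.trans hC1
  refine ⟨δ, C, hδ0, lt_of_lt_of_le hc₁ hC1, ?_⟩
  intro P hPd hPL k hk1 hkK c M0 hM0 hfit0 hN0 s W hs R R₀ R₁ hR hR₁ hR10 hW hgap h x μ hx hdeep hxe hdeepe f F D hF hD hsupp
  have hn : 1 ≤ P.L ^ k := Nat.one_le_pow _ _ P.L_pos
  have hk : 0 + k ≤ P.m + P.K := by omega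
  have hR0 : 0 ≤ R := zero_le_one.trans hR.le
  have hR₀ : 0 ≤ R₀ := hR₁.trans hR10.le
  have hs0 : 0 < s := hs
  have hsr : (0 : ℝ) < s := by exact_mod_cast hs0
  have hgap' : 0 < R₀ - R₁ := sub_pos.2 hR10
  have hLpos : (0 : ℝ) < P.L := P.cast_L_pos
  have hLk : (0 : ℝ) < (P.L : ℝ) ^ k := pow_pos hLpos _
  have hε : 0 < ((P.L : ℝ) ^ k)⁻¹ := inv_pos.mpr hLk
  have hF0 : 0 ≤ F := (norm_nonneg _).trans (hF x)
  have hsp0 : 0 < P.spacing k := P.spacing_pos k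
  have heps : 0 < P.eps := P.eps_pos
  have hζ0 := cutoff_eq_zero_of_le (P := P) hR10
  -- the shallower depth `R₀` (row hypothesis (i), the label multiplicities) at both endpoints
  have hdeep₀ := depth_mono hPd (show R₀ ≤ R₀ + R by linarith) hdeep
  have hdeepe₀ := depth_mono hPd (show R₀ ≤ R₀ + R by linarith) hdeepe
  -- abbreviations
  set Ω₀ : Finset (Balaban1983to89.Site P 0) := cubeT hPd (P.L ^ k) c fun i => P.L ^ k * M0 i with hΩ₀def
  set A : ℝ := B1RG242Torus.α P a k * (P.L : ℝ) ^ (k * P.d) with hAdef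
  set U : GaugeField P 0 U1 := gaugeAct h (1 : GaugeField P 0 U1) with hUdef
  set ζ := cutoff R₁ R₀ (B5Ineq137Torus.T P 0) with hζdef
  set x' := x.shift μ with hx'def
  set G₀ := gBox A P.eps⁻¹ U k univ with hG₀def
  set m : ℝ := ((⌊(((P.L : ℝ) ^ k) - 1 + R₀) / s⌋₊ : ℝ) + 3) ^ (d + 1) with hmdef
  have hm0 : 0 ≤ m := by rw [hmdef]; positivity
  set E : ℝ := Real.exp (-(δ / 2 * (((P.L : ℝ) ^ k)⁻¹ * D))) with hEdef
  set E2R : ℝ := Real.exp (-(δ * (((P.L : ℝ) ^ k)⁻¹ * (2 * R - 1)))) with hE2Rdef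
  set ER1 : ℝ := Real.exp (-(δ / 2 * (((P.L : ℝ) ^ k)⁻¹ * (R₁ - 1)))) with hER1def
  have hE0 : 0 < E := Real.exp_pos _
  have hE2R0 : 0 < E2R := Real.exp_pos _
  have hER10 : 0 < ER1 := Real.exp_pos _
  have hεD : 0 ≤ ((P.L : ℝ) ^ k)⁻¹ * D := mul_nonneg hε.le hD
  have hε2R : 0 ≤ ((P.L : ℝ) ^ k)⁻¹ * (2 * R - 1) := mul_nonneg hε.le (by linarith)
  -- exponent bookkeeping: `e^{−δ_iD/L^k} ≤ E`-type facts
  have hED : ∀ {δ'}, δ ≤ δ' → Real.exp (-(δ' * (((P.L : ℝ) ^ k)⁻¹ * D))) ≤ E := by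
    intro δ' hδ'
    refine (exp_le_exp_of_rate hδ' hεD).trans (Real.exp_le_exp.2 ?_)
    have := mul_nonneg hδ0.le hεD
    linarith
  have hE2 : ∀ {δ'}, δ ≤ δ' → Real.exp (-(δ' * (((P.L : ℝ) ^ k)⁻¹ * (R - 1 + R)))) ≤ E2R := by
    intro δ' hδ'
    rw [show R - 1 + R = 2 * R - 1 by ring]
    exact exp_le_exp_of_rate hδ' hε2R
  set D' : ℝ := max D (R₁ - 1) with hD'def
  have hD'D : D ≤ D' := le_max_left _ _
  have hD'R : R₁ - 1 ≤ D' := le_max_right _ _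
  have hD'0 : 0 ≤ D' := hD.trans hD'D
  have hED' : ∀ {δ'}, δ ≤ δ' → Real.exp (-(δ' * (((P.L : ℝ) ^ k)⁻¹ * D'))) ≤ E * ER1 := by
    intro δ' hδ'
    rw [hEdef, hER1def, ← Real.exp_add]
    refine Real.exp_le_exp.2 ?_
    have hD'0' : 0 ≤ ((P.L : ℝ) ^ k)⁻¹ * D' := mul_nonneg hε.le hD'0
    have h1 : δ * (((P.L : ℝ) ^ k)⁻¹ * D') ≤ δ' * (((P.L : ℝ) ^ k)⁻¹ * D') := mul_le_mul_of_nonneg_right hδ' hD'0'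
    have h2 : δ / 2 * (((P.L : ℝ) ^ k)⁻¹ * D) + δ / 2 * (((P.L : ℝ) ^ k)⁻¹ * (R₁ - 1)) ≤ δ * (((P.L : ℝ) ^ k)⁻¹ * D') := by
      have : D + (R₁ - 1) ≤ 2 * D' := by linarith
      calc δ / 2 * (((P.L : ℝ) ^ k)⁻¹ * D) + δ / 2 * (((P.L : ℝ) ^ k)⁻¹ * (R₁ - 1))
          = δ / 2 * (((P.L : ℝ) ^ k)⁻¹ * (D + (R₁ - 1))) := by ring
        _ ≤ δ / 2 * (((P.L : ℝ) ^ k)⁻¹ * (2 * D')) :=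
            mul_le_mul_of_nonneg_left (mul_le_mul_of_nonneg_left this hε.le) (by positivity)
        _ = δ * (((P.L : ℝ) ^ k)⁻¹ * D') := by ring
    linarith
  -- the sources
  set g' : ↥(labels (P.L ^ k) M0 s) → Balaban1983to89.Site P 0 → ℂ :=
    fun α y => (ζ x' y : ℂ) * (lamFam hPd (P.L ^ k) c M0 s α x' y : ℂ) * f y with hg'def
  set dg : ↥(labels (P.L ^ k) M0 s) → Balaban1983to89.Site P 0 → ℂ :=
    fun α y => ((ζ x' y : ℂ) * (lamFam hPd (P.L ^ k) c M0 s α x' y : ℂ) - (ζ x y : ℂ) * (lamFam hPd (P.L ^ k) c M0 s α x y : ℂ)) * f y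
    with hdgdef
  set q' : Balaban1983to89.Site P 0 → ℂ := fun y => ((ζ x' y : ℂ) - 1) * f y with hq'def
  set dq : Balaban1983to89.Site P 0 → ℂ := fun y => ((ζ x' y : ℂ) - (ζ x y : ℂ)) * f y with hdqdef
  -- the four-term identity (row hypothesis (i) at both endpoints)
  have hid : covD P.eps⁻¹ (cfg U) (gLocT A P.eps⁻¹ U k (cubeFam hPd (P.L ^ k) c M0 s W) (lamFam hPd (P.L ^ k) c M0 s) ζ *ᵥ f) ⟨x, μ⟩ -
      covD P.eps⁻¹ (cfg U) (G₀ *ᵥ f) ⟨x, μ⟩ =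
      ∑ α, (covD P.eps⁻¹ (cfg U) (gBox A P.eps⁻¹ U k (cubeFam hPd (P.L ^ k) c M0 s W α) *ᵥ g' α) ⟨x, μ⟩ -
              covD P.eps⁻¹ (cfg U) (G₀ *ᵥ g' α) ⟨x, μ⟩) +
      ∑ α, ((P.eps⁻¹ : ℝ) : ℂ) * ((gBox A P.eps⁻¹ U k (cubeFam hPd (P.L ^ k) c M0 s W α) *ᵥ dg α) x - (G₀ *ᵥ dg α) x) +
      covD P.eps⁻¹ (cfg U) (G₀ *ᵥ q') ⟨x, μ⟩ + ((P.eps⁻¹ : ℝ) : ℂ) * (G₀ *ᵥ dq) x :=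
    covD_gLocT_sub_apply P.eps⁻¹ (cfg U) A P.eps⁻¹ U k (cubeFam hPd (P.L ^ k) c M0 s W) (lamFam hPd (P.L ^ k) c M0 s) ζ G₀ f ⟨x, μ⟩
      (rowHyp_i hPd hfit0 hζ0 hxe hdeepe₀) (rowHyp_i hPd hfit0 hζ0 hx hdeep₀)
  rw [hid]
  -- the active-label sets of the two endpoints
  set Sx : Finset ↥(labels (P.L ^ k) M0 s) := (activeLabels hPd (P.L ^ k) c s R₀ (blkIter k x)).subtype fun α => α ∈ labels (P.L ^ k) M0 s
    with hSxdef
  set Sx' : Finset ↥(labels (P.L ^ k) M0 s) := (activeLabels hPd (P.L ^ k) c s R₀ (blkIter k x')).subtype fun α => α ∈ labels (P.L ^ k) M0 s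
    with hSx'def
  have hcardx : (Sx.card : ℝ) ≤ m := by
    have h1 := card_subtype_activeLabels_le (hPd := hPd) (c := c) (M0 := M0) hn hs0 hR₀ (blkIter k x)
    have e : (((P.L ^ k : ℕ) : ℕ) : ℝ) = (P.L : ℝ) ^ k := by push_cast; rfl
    rw [hSxdef, hmdef]; rw [e] at h1; exact h1
  have hcardx' : (Sx'.card : ℝ) ≤ m := by
    have h1 := card_subtype_activeLabels_le (hPd := hPd) (c := c) (M0 := M0) hn hs0 hR₀ (blkIter k x')
    have e : (((P.L ^ k : ℕ) : ℕ) : ℝ) = (P.L : ℝ) ^ k := by push_cast; rfl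
    rw [hSx'def, hmdef]; rw [e] at h1; exact h1
  have hSx : ∀ (α : ↥(labels (P.L ^ k) M0 s)) (y : Balaban1983to89.Site P 0),
      ζ x y * lamFam hPd (P.L ^ k) c M0 s α x y ≠ 0 → α ∈ Sx := by
    intro α y hne
    rw [hSxdef, Finset.mem_subtype]
    exact mem_activeLabels_of_ne_zero_of_deep hk hs0 hfit0 hζ0 (mem_blockK.2 rfl) hdeep₀ hne
  have hSx' : ∀ (α : ↥(labels (P.L ^ k) M0 s)) (y : Balaban1983to89.Site P 0),
      ζ x' y * lamFam hPd (P.L ^ k) c M0 s α x' y ≠ 0 → α ∈ Sx' := by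
    intro α y hne
    rw [hSx'def, Finset.mem_subtype]
    exact mem_activeLabels_of_ne_zero_of_deep hk hs0 hfit0 hζ0 (mem_blockK.2 rfl) hdeepe₀ hne
  have hcardU : ((Sx ∪ Sx').card : ℝ) ≤ 2 * m := by
    have h1 : ((Sx ∪ Sx').card : ℝ) ≤ (Sx.card : ℝ) + (Sx'.card : ℝ) := by exact_mod_cast Finset.card_union_le _ _
    linarith
  -- geometry of an active cube READ AGAINST THE WHOLE TORUS: both endpoints and the active sources inside, `T_η ∖ □_α` far
  have hstep : B5Ineq137Torus.T P 0 x' x ≤ 1 := by rw [B5Ineq137Torus.T_symm]; exact T_shift_le_one x μ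
  have hgeo' : ∀ (α : ↥(labels (P.L ^ k) M0 s)) (y₀ : Balaban1983to89.Site P 0), ζ x' y₀ * lamFam hPd (P.L ^ k) c M0 s α x' y₀ ≠ 0 →
      x ∈ cubeFam hPd (P.L ^ k) c M0 s W α ∧ x' ∈ cubeFam hPd (P.L ^ k) c M0 s W α ∧
      (∀ w, w ∉ cubeFam hPd (P.L ^ k) c M0 s W α → R - 1 ≤ B5Ineq137Torus.T P 0 x w) := by
    intro α y₀ hy₀
    obtain ⟨hx'α, -, hfar⟩ := rowHyp_ii_torus hPd hn hs0 hfit0 hR0 hR₀ hgap hW hζ0 hxe hdeepe α y₀ hy₀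
    have hxα : x ∈ cubeFam hPd (P.L ^ k) c M0 s W α := by
      by_contra hnot
      have h1 := (hfar x hnot).1
      linarith
    refine ⟨hxα, hx'α, fun w hnot => ?_⟩
    have h1 := (hfar w hnot).1
    have h2 := abs_le.1 (abs_T_shift_sub_le x w μ)
    linarith
  have hgeo : ∀ (α : ↥(labels (P.L ^ k) M0 s)) (y₀ : Balaban1983to89.Site P 0), ζ x y₀ * lamFam hPd (P.L ^ k) c M0 s α x y₀ ≠ 0 →
      x ∈ cubeFam hPd (P.L ^ k) c M0 s W α ∧
      (∀ w, w ∉ cubeFam hPd (P.L ^ k) c M0 s W α → R - 1 ≤ B5Ineq137Torus.T P 0 x w) := by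
    intro α y₀ hy₀
    obtain ⟨hxα, -, hfar⟩ := rowHyp_ii_torus hPd hn hs0 hfit0 hR0 hR₀ hgap hW hζ0 hx hdeep α y₀ hy₀
    exact ⟨hxα, fun w hnot => by linarith [(hfar w hnot).1]⟩
  have hζabs : ∀ z y, |ζ z y| ≤ 1 := fun z y => by
    rw [hζdef, abs_of_nonneg (cutoff_nonneg _ _ _ _ _)]; exact cutoff_le_one _ _ _ _ _
  -- TERM 1: [6] (1.11)–(1.12) at A = 0 for □_α ⊂ T_η, derivative member (r01), for the cubes active at `x'`
  set B₁ : ℝ := P.spacing k * (c₁ * Real.exp (-(δ₁ * (((P.L : ℝ) ^ k)⁻¹ * D))) *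
    Real.exp (-(δ₁ * (((P.L : ℝ) ^ k)⁻¹ * (R - 1 + R)))) * F) with hB₁def
  have hB₁0 : 0 ≤ B₁ := by positivity
  have hterm1 : ∀ α, ‖covD P.eps⁻¹ (cfg U) (gBox A P.eps⁻¹ U k (cubeFam hPd (P.L ^ k) c M0 s W α) *ᵥ g' α) ⟨x, μ⟩ -
      covD P.eps⁻¹ (cfg U) (G₀ *ᵥ g' α) ⟨x, μ⟩‖ ≤ B₁ := by
    intro α
    by_cases hex : ∃ y, ζ x' y * lamFam hPd (P.L ^ k) c M0 s α x' y ≠ 0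
    · obtain ⟨y₀, hy₀⟩ := hex
      obtain ⟨hxα, hx'α, hfarx⟩ := hgeo' α y₀ hy₀
      obtain ⟨c', M', hM', hfit', hN', hcα⟩ := cubeFam_fits (hPd := hPd) (n := P.L ^ k) (c := c) (s := s) (W := W) hM0 hfit0 hN0 α
      have hsuppα : ∀ y, y ∉ cubeFam hPd (P.L ^ k) c M0 s W α → g' α y = 0 := by
        intro y hy
        by_contra hne
        exact hy (rowHyp_ii_torus hPd hn hs0 hfit0 hR0 hR₀ hgap hW hζ0 hxe hdeepe α y (rowSource_ne_zero hne).1).2.1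
      have hDf : ∀ y, g' α y ≠ 0 → ∀ w, w ∉ cubeFam hPd (P.L ^ k) c M0 s W α → R ≤ B5Ineq137Torus.T P 0 y w :=
        fun y hy w hw' => ((rowHyp_ii_torus hPd hn hs0 hfit0 hR0 hR₀ hgap hW hζ0 hxe hdeepe α y (rowSource_ne_zero hy).1).2.2 w hw').2
      rw [hcα] at hxα hx'α hfarx hsuppα hDf ⊢
      have h1 := H1 P hPd hPL k hk1 hkK c' M' hM' hfit' hN' h x μ hxα hx'α (g' α) F D (R - 1) R
        (fun y => norm_rowSource_le (hζabs x' y) (abs_lam_le_one (sum_abs_lamT_le_one hfit0) α x' y) hF y)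
        hsuppα (fun y hy => hsupp y (rowSource_ne_zero hy).2) hfarx hDf
      calc ‖covD P.eps⁻¹ (cfg U) (gBox A P.eps⁻¹ U k (cubeT hPd (P.L ^ k) c' fun i => P.L ^ k * M' i) *ᵥ g' α) ⟨x, μ⟩ -
              covD P.eps⁻¹ (cfg U) (G₀ *ᵥ g' α) ⟨x, μ⟩‖
          ≤ c₁ * P.spacing k * Real.exp (-(δ₁ * (D / (P.L : ℝ) ^ k))) * Real.exp (-(δ₁ * ((R - 1 + R) / (P.L : ℝ) ^ k))) * F := h1
        _ = B₁ := by rw [hB₁def, div_eq_inv_mul, div_eq_inv_mul]; ring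
    · push Not at hex
      have h0 : g' α = 0 := by
        funext y; rw [hg'def]; dsimp only; rw [← Complex.ofReal_mul, hex y, Complex.ofReal_zero, zero_mul]; rfl
      rw [h0, mulVec_zero, mulVec_zero]
      simp only [covD, Pi.zero_apply, mul_zero, sub_zero, norm_zero]
      exact hB₁0
  have hzero1 : ∀ α, α ∉ Sx' → covD P.eps⁻¹ (cfg U) (gBox A P.eps⁻¹ U k (cubeFam hPd (P.L ^ k) c M0 s W α) *ᵥ g' α) ⟨x, μ⟩ -
      covD P.eps⁻¹ (cfg U) (G₀ *ᵥ g' α) ⟨x, μ⟩ = 0 := by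
    intro α hα
    have h0 : g' α = 0 := by
      funext y
      by_contra hne
      exact hα (hSx' α y (rowSource_ne_zero hne).1)
    rw [h0, mulVec_zero, mulVec_zero]
    simp only [covD, Pi.zero_apply, mul_zero, sub_zero]
  have hsum1 : ‖∑ α, (covD P.eps⁻¹ (cfg U) (gBox A P.eps⁻¹ U k (cubeFam hPd (P.L ^ k) c M0 s W α) *ᵥ g' α) ⟨x, μ⟩ -
      covD P.eps⁻¹ (cfg U) (G₀ *ᵥ g' α) ⟨x, μ⟩)‖ ≤ m * B₁ := by
    rw [← Finset.sum_subset (Finset.subset_univ Sx') (fun α _ hα => hzero1 α hα)]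
    calc ‖∑ α ∈ Sx', (covD P.eps⁻¹ (cfg U) (gBox A P.eps⁻¹ U k (cubeFam hPd (P.L ^ k) c M0 s W α) *ᵥ g' α) ⟨x, μ⟩ -
            covD P.eps⁻¹ (cfg U) (G₀ *ᵥ g' α) ⟨x, μ⟩)‖
        ≤ ∑ α ∈ Sx', ‖covD P.eps⁻¹ (cfg U) (gBox A P.eps⁻¹ U k (cubeFam hPd (P.L ^ k) c M0 s W α) *ᵥ g' α) ⟨x, μ⟩ -
            covD P.eps⁻¹ (cfg U) (G₀ *ᵥ g' α) ⟨x, μ⟩‖ := norm_sum_le _ _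
      _ ≤ ∑ α ∈ Sx', B₁ := Finset.sum_le_sum fun α _ => hterm1 α
      _ = Sx'.card * B₁ := by rw [Finset.sum_const, nsmul_eq_mul]
      _ ≤ m * B₁ := mul_le_mul_of_nonneg_right hcardx' hB₁0
  -- TERM 2: [6] (1.11)–(1.12) at A = 0 for □_α ⊂ T_η, value member (r01), on the difference sources, cubes active at `x` or `x'`
  set Λ : ℝ := K / (R₀ - R₁) + 3 * Real.pi * (d + 1 : ℕ) / (2 * s) with hΛdef
  have hΛ0 : 0 ≤ Λ := by rw [hΛdef]; positivity
  set B₂ : ℝ := P.spacing k ^ 2 * (c₂ * Real.exp (-(δ₂ * (((P.L : ℝ) ^ k)⁻¹ * D))) *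
    Real.exp (-(δ₂ * (((P.L : ℝ) ^ k)⁻¹ * (R - 1 + R)))) * (Λ * F)) with hB₂def
  have hB₂0 : 0 ≤ B₂ := by positivity
  have hterm2 : ∀ α, ‖(gBox A P.eps⁻¹ U k (cubeFam hPd (P.L ^ k) c M0 s W α) *ᵥ dg α) x - (G₀ *ᵥ dg α) x‖ ≤ B₂ := by
    intro α
    by_cases hex : ∃ y, dg α y ≠ 0
    · obtain ⟨y₀, hy₀⟩ := hex
      -- an active pair at one endpoint: `x` is in the cube and `T_η ∖ □_α` is `≥ R − 1` away from `x`
      have hact : ∀ y, dg α y ≠ 0 → ζ x' y * lamFam hPd (P.L ^ k) c M0 s α x' y ≠ 0 ∨ ζ x y * lamFam hPd (P.L ^ k) c M0 s α x y ≠ 0 := by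
        intro y hy
        by_contra hno
        rw [not_or, not_not, not_not] at hno
        apply hy
        rw [hdgdef]; dsimp only
        rw [← Complex.ofReal_mul, ← Complex.ofReal_mul, hno.1, hno.2]; simp
      have hxfar : x ∈ cubeFam hPd (P.L ^ k) c M0 s W α ∧
          ∀ w, w ∉ cubeFam hPd (P.L ^ k) c M0 s W α → R - 1 ≤ B5Ineq137Torus.T P 0 x w := by
        rcases hact y₀ hy₀ with h1 | h1
        · exact ⟨(hgeo' α y₀ h1).1, (hgeo' α y₀ h1).2.2⟩
        · exact hgeo α y₀ h1
      obtain ⟨hxα, hfarx⟩ := hxfar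
      obtain ⟨c', M', hM', hfit', hN', hcα⟩ := cubeFam_fits (hPd := hPd) (n := P.L ^ k) (c := c) (s := s) (W := W) hM0 hfit0 hN0 α
      have hsuppα : ∀ y, y ∉ cubeFam hPd (P.L ^ k) c M0 s W α → dg α y = 0 := by
        intro y hy
        by_contra hne
        rcases hact y hne with h1 | h1
        · exact hy (rowHyp_ii_torus hPd hn hs0 hfit0 hR0 hR₀ hgap hW hζ0 hxe hdeepe α y h1).2.1
        · exact hy (rowHyp_ii_torus hPd hn hs0 hfit0 hR0 hR₀ hgap hW hζ0 hx hdeep α y h1).2.1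
      have hDf : ∀ y, dg α y ≠ 0 → ∀ w, w ∉ cubeFam hPd (P.L ^ k) c M0 s W α → R ≤ B5Ineq137Torus.T P 0 y w := by
        intro y hy w hw'
        rcases hact y hy with h1 | h1
        · exact ((rowHyp_ii_torus hPd hn hs0 hfit0 hR0 hR₀ hgap hW hζ0 hxe hdeepe α y h1).2.2 w hw').2
        · exact ((rowHyp_ii_torus hPd hn hs0 hfit0 hR0 hR₀ hgap hW hζ0 hx hdeep α y h1).2.2 w hw').2
      rw [hcα] at hxα hfarx hsuppα hDf ⊢
      have h2 := H2 P hPd hPL k hk1 hkK c' M' hM' hfit' hN' h x hxα (dg α) (Λ * F) D (R - 1) R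
        (fun y => norm_rowSource_sub_le hPd hs0 hfit0 hN0 hK0 hR10 (hK R₁ R₀ hR10 (B5Ineq137Torus.T P 0)) α.1 hx hxe hF y)
        hsuppα (fun y hy => hsupp y (right_ne_zero_of_mul hy)) hfarx hDf
      calc ‖(gBox A P.eps⁻¹ U k (cubeT hPd (P.L ^ k) c' fun i => P.L ^ k * M' i) *ᵥ dg α) x - (G₀ *ᵥ dg α) x‖
          ≤ c₂ * P.spacing k ^ 2 * Real.exp (-(δ₂ * (D / (P.L : ℝ) ^ k))) * Real.exp (-(δ₂ * ((R - 1 + R) / (P.L : ℝ) ^ k))) * (Λ * F) := by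
            have e : (gBox A P.eps⁻¹ U k (cubeT hPd (P.L ^ k) c' fun i => P.L ^ k * M' i) *ᵥ dg α) x - (G₀ *ᵥ dg α) x =
                ((gBox A P.eps⁻¹ U k (cubeT hPd (P.L ^ k) c' fun i => P.L ^ k * M' i) *ᵥ dg α) x -
                  (gBox A P.eps⁻¹ U k univ *ᵥ dg α) x) := by rw [hG₀def]
            rw [e]; exact h2
        _ = B₂ := by rw [hB₂def, div_eq_inv_mul, div_eq_inv_mul]; ring
    · push Not at hex
      have h0 : dg α = 0 := funext hex
      rw [h0, mulVec_zero, mulVec_zero, Pi.zero_apply, sub_zero, norm_zero]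
      exact hB₂0
  have hzero2 : ∀ α, α ∉ Sx ∪ Sx' → (gBox A P.eps⁻¹ U k (cubeFam hPd (P.L ^ k) c M0 s W α) *ᵥ dg α) x - (G₀ *ᵥ dg α) x = 0 := by
    intro α hα
    rw [Finset.mem_union, not_or] at hα
    have h0 : dg α = 0 := by
      funext y
      rw [hdgdef]; dsimp only
      have h1 : ζ x' y * lamFam hPd (P.L ^ k) c M0 s α x' y = 0 := by
        by_contra hne; exact hα.2 (hSx' α y hne)
      have h2 : ζ x y * lamFam hPd (P.L ^ k) c M0 s α x y = 0 := by
        by_contra hne; exact hα.1 (hSx α y hne)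
      rw [← Complex.ofReal_mul, ← Complex.ofReal_mul, h1, h2]; simp
    rw [h0, mulVec_zero, mulVec_zero, Pi.zero_apply, sub_zero]
  have hsum2 : ‖∑ α, ((P.eps⁻¹ : ℝ) : ℂ) * ((gBox A P.eps⁻¹ U k (cubeFam hPd (P.L ^ k) c M0 s W α) *ᵥ dg α) x - (G₀ *ᵥ dg α) x)‖ ≤
      P.eps⁻¹ * (2 * m * B₂) := by
    rw [← Finset.mul_sum, norm_mul, Complex.norm_real, Real.norm_eq_abs, abs_of_pos (inv_pos.mpr heps)]
    refine mul_le_mul_of_nonneg_left ?_ (inv_pos.mpr heps).le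
    rw [← Finset.sum_subset (Finset.subset_univ (Sx ∪ Sx')) (fun α _ hα => hzero2 α hα)]
    calc ‖∑ α ∈ Sx ∪ Sx', ((gBox A P.eps⁻¹ U k (cubeFam hPd (P.L ^ k) c M0 s W α) *ᵥ dg α) x - (G₀ *ᵥ dg α) x)‖
        ≤ ∑ α ∈ Sx ∪ Sx', ‖(gBox A P.eps⁻¹ U k (cubeFam hPd (P.L ^ k) c M0 s W α) *ᵥ dg α) x - (G₀ *ᵥ dg α) x‖ := norm_sum_le _ _
      _ ≤ ∑ α ∈ Sx ∪ Sx', B₂ := Finset.sum_le_sum fun α _ => hterm2 α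
      _ = (Sx ∪ Sx').card * B₂ := by rw [Finset.sum_const, nsmul_eq_mul]
      _ ≤ 2 * m * B₂ := mul_le_mul_of_nonneg_right hcardU hB₂0
  -- TERM 3: [6] (1.10) for G_k(T_η,1^h), derivative member (r18 g19), on the tail `q'`
  set B₃ : ℝ := P.spacing k * (c₃ * Real.exp (-(δ₃ * (((P.L : ℝ) ^ k)⁻¹ * D'))) * F) with hB₃def
  have hterm3 : ‖covD P.eps⁻¹ (cfg U) (G₀ *ᵥ q') ⟨x, μ⟩‖ ≤ B₃ := by
    have hsq : ∀ y, q' y ≠ 0 → D' ≤ B5Ineq137Torus.T P 0 x y := fun y hy => by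
      obtain ⟨hf, hT⟩ := T_gt_of_tail_ne_zero hR10 x μ hy
      exact max_le (hsupp y hf) hT.le
    have h3 := (H3 P hPd hPL k hk1 hkK h x q' F D' (fun y => norm_tail_le x' hF y) hD'0 hsq).2 μ
    calc ‖covD P.eps⁻¹ (cfg U) (G₀ *ᵥ q') ⟨x, μ⟩‖ ≤ c₃ * P.spacing k * Real.exp (-(δ₃ * (D' / (P.L : ℝ) ^ k))) * F := h3
      _ = B₃ := by rw [hB₃def, div_eq_inv_mul]; ring
  -- TERM 4: [6] (1.10) for G_k(T_η,1^h), value member (r18 g19), on the tail difference `dq`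
  set B₄ : ℝ := P.spacing k ^ 2 * (c₄ * Real.exp (-(δ₄ * (((P.L : ℝ) ^ k)⁻¹ * D'))) * (K / (R₀ - R₁) * F)) with hB₄def
  have hterm4 : ‖((P.eps⁻¹ : ℝ) : ℂ) * (G₀ *ᵥ dq) x‖ ≤ P.eps⁻¹ * B₄ := by
    rw [norm_mul, Complex.norm_real, Real.norm_eq_abs, abs_of_pos (inv_pos.mpr heps)]
    refine mul_le_mul_of_nonneg_left ?_ (inv_pos.mpr heps).le
    have hsq : ∀ y, dq y ≠ 0 → D' ≤ B5Ineq137Torus.T P 0 x y := fun y hy => by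
      obtain ⟨hf, hT⟩ := T_gt_of_tailDiff_ne_zero hR10 x μ hy
      exact max_le (hsupp y hf) hT.le
    have h4 := (H4 P hPd hPL k hk1 hkK h x dq (K / (R₀ - R₁) * F) D'
      (fun y => norm_tailDiff_le hK0 hR10 (hK R₁ R₀ hR10 (B5Ineq137Torus.T P 0)) x μ hF y) hD'0 hsq).1
    calc ‖(G₀ *ᵥ dq) x‖ ≤ c₄ * P.spacing k ^ 2 * Real.exp (-(δ₄ * (D' / (P.L : ℝ) ^ k))) * (K / (R₀ - R₁) * F) := h4
      _ = B₄ := by rw [hB₄def, div_eq_inv_mul]; ring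
  -- assembling (verbatim from p29's `deriv231_flat_cwt`)
  have hscale : P.eps⁻¹ * P.spacing k ^ 2 = P.spacing k * (P.L : ℝ) ^ k := by
    rw [Params.spacing]
    field_simp
  have hΛle : Λ ≤ Λ₀ * ((R₀ - R₁)⁻¹ + (s : ℝ)⁻¹) := by
    rw [hΛdef, mul_add]
    refine add_le_add ?_ ?_
    · rw [div_eq_mul_inv]
      exact mul_le_mul_of_nonneg_right (le_max_left _ _) (inv_pos.mpr hgap').le
    · have e : 3 * Real.pi * (d + 1 : ℕ) / (2 * s) = (3 * Real.pi * (d + 1 : ℕ) / 2) * (s : ℝ)⁻¹ := by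
        field_simp
      rw [e]
      exact mul_le_mul_of_nonneg_right (le_max_right _ _) (inv_pos.mpr hsr).le
  have hKle : K / (R₀ - R₁) ≤ Λ₀ * (R₀ - R₁)⁻¹ := by
    rw [div_eq_mul_inv]; exact mul_le_mul_of_nonneg_right hΛ₀K (inv_pos.mpr hgap').le
  -- term 1 ≤ spacing·(C·m·E2R·E·F)
  have h1 : m * B₁ ≤ P.spacing k * (C * (m * 1 * E2R) * E * F) := by
    have : B₁ ≤ P.spacing k * (C * E2R * E * F) := by
      rw [hB₁def]
      refine mul_le_mul_of_nonneg_left ?_ hsp0.le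
      have := mul_le_mul (mul_le_mul hC1 (hED hδ1) (Real.exp_pos _).le hC0) (hE2 hδ1) (Real.exp_pos _).le (by positivity)
      calc c₁ * Real.exp (-(δ₁ * (((P.L : ℝ) ^ k)⁻¹ * D))) * Real.exp (-(δ₁ * (((P.L : ℝ) ^ k)⁻¹ * (R - 1 + R)))) * F
          ≤ C * E * E2R * F := mul_le_mul_of_nonneg_right this hF0
        _ = C * E2R * E * F := by ring
    calc m * B₁ ≤ m * (P.spacing k * (C * E2R * E * F)) := mul_le_mul_of_nonneg_left this hm0
      _ = P.spacing k * (C * (m * 1 * E2R) * E * F) := by ring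
  -- term 2 ≤ spacing·(C·m·L^k((R₀−R₁)⁻¹ + s⁻¹)·E2R·E·F)
  have h2 : P.eps⁻¹ * (2 * m * B₂) ≤ P.spacing k * (C * (m * ((P.L : ℝ) ^ k * ((R₀ - R₁)⁻¹ + (s : ℝ)⁻¹)) * E2R) * E * F) := by
    have e : P.eps⁻¹ * (2 * m * B₂) = P.spacing k * ((2 * c₂ * Λ) * m * (P.L : ℝ) ^ k *
        (Real.exp (-(δ₂ * (((P.L : ℝ) ^ k)⁻¹ * D))) * Real.exp (-(δ₂ * (((P.L : ℝ) ^ k)⁻¹ * (R - 1 + R))))) * F) := by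
      rw [hB₂def]
      have : P.eps⁻¹ * (2 * m * (P.spacing k ^ 2 * (c₂ * Real.exp (-(δ₂ * (((P.L : ℝ) ^ k)⁻¹ * D))) *
          Real.exp (-(δ₂ * (((P.L : ℝ) ^ k)⁻¹ * (R - 1 + R)))) * (Λ * F)))) =
          (P.eps⁻¹ * P.spacing k ^ 2) * (2 * c₂ * Λ * m *
            (Real.exp (-(δ₂ * (((P.L : ℝ) ^ k)⁻¹ * D))) * Real.exp (-(δ₂ * (((P.L : ℝ) ^ k)⁻¹ * (R - 1 + R))))) * F) := by ring
      rw [this, hscale]; ring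
    rw [e]
    refine mul_le_mul_of_nonneg_left ?_ hsp0.le
    have hcoef : 2 * c₂ * Λ * m * (P.L : ℝ) ^ k ≤ C * (m * ((P.L : ℝ) ^ k * ((R₀ - R₁)⁻¹ + (s : ℝ)⁻¹))) := by
      have h3 : 2 * c₂ * Λ ≤ C * ((R₀ - R₁)⁻¹ + (s : ℝ)⁻¹) := by
        calc 2 * c₂ * Λ ≤ 2 * c₂ * (Λ₀ * ((R₀ - R₁)⁻¹ + (s : ℝ)⁻¹)) := mul_le_mul_of_nonneg_left hΛle (by positivity)
          _ = (2 * c₂ * Λ₀) * ((R₀ - R₁)⁻¹ + (s : ℝ)⁻¹) := by ring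
          _ ≤ C * ((R₀ - R₁)⁻¹ + (s : ℝ)⁻¹) := mul_le_mul_of_nonneg_right (by linarith) (by positivity)
      calc 2 * c₂ * Λ * m * (P.L : ℝ) ^ k = (2 * c₂ * Λ) * (m * (P.L : ℝ) ^ k) := by ring
        _ ≤ (C * ((R₀ - R₁)⁻¹ + (s : ℝ)⁻¹)) * (m * (P.L : ℝ) ^ k) := mul_le_mul_of_nonneg_right h3 (by positivity)
        _ = C * (m * ((P.L : ℝ) ^ k * ((R₀ - R₁)⁻¹ + (s : ℝ)⁻¹))) := by ring
    have hexp : Real.exp (-(δ₂ * (((P.L : ℝ) ^ k)⁻¹ * D))) * Real.exp (-(δ₂ * (((P.L : ℝ) ^ k)⁻¹ * (R - 1 + R)))) ≤ E2R * E := by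
      calc _ ≤ E * E2R := mul_le_mul (hED hδ2) (hE2 hδ2) (Real.exp_pos _).le hE0.le
        _ = E2R * E := mul_comm _ _
    calc 2 * c₂ * Λ * m * (P.L : ℝ) ^ k *
          (Real.exp (-(δ₂ * (((P.L : ℝ) ^ k)⁻¹ * D))) * Real.exp (-(δ₂ * (((P.L : ℝ) ^ k)⁻¹ * (R - 1 + R))))) * F
        ≤ C * (m * ((P.L : ℝ) ^ k * ((R₀ - R₁)⁻¹ + (s : ℝ)⁻¹))) * (E2R * E) * F :=
          mul_le_mul_of_nonneg_right (mul_le_mul hcoef hexp (by positivity) (by positivity)) hF0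
      _ = C * (m * ((P.L : ℝ) ^ k * ((R₀ - R₁)⁻¹ + (s : ℝ)⁻¹)) * E2R) * E * F := by ring
  -- term 3 ≤ spacing·(C·1·ER1·E·F)
  have h3 : B₃ ≤ P.spacing k * (C * (1 * ER1) * E * F) := by
    rw [hB₃def]
    refine mul_le_mul_of_nonneg_left ?_ hsp0.le
    calc c₃ * Real.exp (-(δ₃ * (((P.L : ℝ) ^ k)⁻¹ * D'))) * F ≤ C * (E * ER1) * F :=
          mul_le_mul_of_nonneg_right (mul_le_mul hC3 (hED' hδ3) (Real.exp_pos _).le hC0) hF0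
      _ = C * (1 * ER1) * E * F := by ring
  -- term 4 ≤ spacing·(C·L^k(R₀−R₁)⁻¹·ER1·E·F)
  have h4 : P.eps⁻¹ * B₄ ≤ P.spacing k * (C * ((P.L : ℝ) ^ k * (R₀ - R₁)⁻¹ * ER1) * E * F) := by
    have e : P.eps⁻¹ * B₄ = P.spacing k * ((c₄ * (K / (R₀ - R₁))) * (P.L : ℝ) ^ k * Real.exp (-(δ₄ * (((P.L : ℝ) ^ k)⁻¹ * D'))) * F) := by
      rw [hB₄def]
      have : P.eps⁻¹ * (P.spacing k ^ 2 * (c₄ * Real.exp (-(δ₄ * (((P.L : ℝ) ^ k)⁻¹ * D'))) * (K / (R₀ - R₁) * F))) =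
          (P.eps⁻¹ * P.spacing k ^ 2) * (c₄ * (K / (R₀ - R₁)) * Real.exp (-(δ₄ * (((P.L : ℝ) ^ k)⁻¹ * D'))) * F) := by ring
      rw [this, hscale]; ring
    rw [e]
    refine mul_le_mul_of_nonneg_left ?_ hsp0.le
    have hcoef : c₄ * (K / (R₀ - R₁)) * (P.L : ℝ) ^ k ≤ C * ((P.L : ℝ) ^ k * (R₀ - R₁)⁻¹) := by
      have h5 : c₄ * (K / (R₀ - R₁)) ≤ C * (R₀ - R₁)⁻¹ := by
        calc c₄ * (K / (R₀ - R₁)) ≤ c₄ * (Λ₀ * (R₀ - R₁)⁻¹) := mul_le_mul_of_nonneg_left hKle hc₄.le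
          _ = (c₄ * Λ₀) * (R₀ - R₁)⁻¹ := by ring
          _ ≤ C * (R₀ - R₁)⁻¹ := mul_le_mul_of_nonneg_right (by linarith) (inv_pos.mpr hgap').le
      calc c₄ * (K / (R₀ - R₁)) * (P.L : ℝ) ^ k ≤ C * (R₀ - R₁)⁻¹ * (P.L : ℝ) ^ k := mul_le_mul_of_nonneg_right h5 hLk.le
        _ = C * ((P.L : ℝ) ^ k * (R₀ - R₁)⁻¹) := by ring
    calc c₄ * (K / (R₀ - R₁)) * (P.L : ℝ) ^ k * Real.exp (-(δ₄ * (((P.L : ℝ) ^ k)⁻¹ * D'))) * F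
        ≤ C * ((P.L : ℝ) ^ k * (R₀ - R₁)⁻¹) * (E * ER1) * F :=
          mul_le_mul_of_nonneg_right (mul_le_mul hcoef (hED' hδ4) (Real.exp_pos _).le (by positivity)) hF0
      _ = C * ((P.L : ℝ) ^ k * (R₀ - R₁)⁻¹ * ER1) * E * F := by ring
  refine ((norm_add_le _ _).trans (add_le_add ((norm_add_le _ _).trans (add_le_add ((norm_add_le _ _).trans
    (add_le_add hsum1 hsum2)) hterm3)) hterm4)).trans ?_
  calc m * B₁ + P.eps⁻¹ * (2 * m * B₂) + B₃ + P.eps⁻¹ * B₄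
      ≤ P.spacing k * (C * (m * 1 * E2R) * E * F) + P.spacing k * (C * (m * ((P.L : ℝ) ^ k * ((R₀ - R₁)⁻¹ + (s : ℝ)⁻¹)) * E2R) * E * F) +
        P.spacing k * (C * (1 * ER1) * E * F) + P.spacing k * (C * ((P.L : ℝ) ^ k * (R₀ - R₁)⁻¹ * ER1) * E * F) :=
        add_le_add (add_le_add (add_le_add h1 h2) h3) h4
    _ = P.spacing k * (C * (m * (1 + (P.L : ℝ) ^ k * ((R₀ - R₁)⁻¹ + (s : ℝ)⁻¹)) * E2R + (1 + (P.L : ℝ) ^ k * (R₀ - R₁)⁻¹) * ER1) * E * F) := by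
        ring

end Deriv

/-! ## §4 Non-vacuity: the hypotheses of §2/§3 met at once on a genuine `Setup.Params` torus, with a POSITIVE torus margin `R` -/

section Instance

/- The instance torus is gen 26's: `d = 1`, `L = 3` (odd, as `Setup` requires), `m = 1`, `K = 3` — `2·3⁴ = 162` fine sites, `54` sites of
`T^{(1)}`; it is produced as a WITNESS inside the two theorems below (structure literal `⟨1, 3, 1, 3, _, _⟩`), so that this file declares no
definition. [cite: Balaban1987RG1, (0.1) p.251] -/

/-- `|T^{(0)}| = 162` for the instance torus. [cite: Balaban1987RG1, (0.1) p.251] -/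
private theorem sites_P3 : (⟨1, 3, 1, 3, le_rfl, ⟨⟨1, rfl⟩, Nat.one_lt_succ_succ 1⟩⟩ : Params).sitesPerDir 0 = 162 := by decide

/-- `|T^{(1)}| = 54` for the instance torus. [cite: Balaban1987RG1, (0.1) p.251] -/
private theorem sites_P3_1 : (⟨1, 3, 1, 3, le_rfl, ⟨⟨1, rfl⟩, Nat.one_lt_succ_succ 1⟩⟩ : Params).sitesPerDir (0 + 1) = 54 := by decide

/-- **THE HYPOTHESES OF `close235_wholeTorus_flat_cwt` ARE JOINTLY SATISFIABLE WITH A POSITIVE TORUS MARGIN** (so (2.35) with `Ω = T_η` for the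
torus data is not a statement about the empty set): THERE IS a `Setup` torus (`ℤ/162`: `d = 1`, `L = 3`, `m = 1`, `K = 3`) on which, at `k = 1`,
for the reference box `Ω₀ = [0, 24)` (`c = 0`, `M₀ = 8`), cube spacing `s = 1`, half-width `W = 3`, radii `R = 1`, `R₁ = 0`, `R₀ = 1` and the
`1`-block site `y₁ = 2 ∈ ℤ/54` (block `[6, 9)`, chart margin `R₀ + R = 2` inside `[0, 24)`), every displayed hypothesis holds — whence the (2.35)
bound with `Ω = T_η` there for every pure gauge `h` and every `y₂`, multiplicity `(⌊(3 − 1 + 1)/1⌋ + 3)^1 = 6`.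
[cite: BalabanImbrieJaffe1988, (2.35) p.263] -/
theorem close235_wholeTorus_flat_cwt_instance :
    ∃ (P : Params) (hPd : P.d = 0 + 1), P.L = 3 ∧ P.sitesPerDir 0 = 162 ∧
    ∃ δ₀ c₀ : ℝ, 0 < δ₀ ∧ 0 < c₀ ∧ ∀ (h : GaugeTransf P 0 U1) (y₂ : Balaban1983to89.Site P (0 + 1)),
      ‖deltaLocT (B1RG242Torus.α P 1 1 * (P.L : ℝ) ^ (1 * P.d)) P.eps⁻¹ (gaugeAct h (1 : GaugeField P 0 U1)) 1
            (cubeFam hPd (P.L ^ 1) (fun _ => 0) (fun _ => 8) 1 3) (lamFam hPd (P.L ^ 1) (fun _ => 0) (fun _ => 8) 1)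
            (cutoff 0 1 (B5Ineq137Torus.T P 0)) (fun _ => 2) y₂ -
          deltaRegion (B1RG242Torus.α P 1 1 * (P.L : ℝ) ^ (1 * P.d)) P.eps⁻¹ (gaugeAct h (1 : GaugeField P 0 U1)) 1 univ (fun _ => 2) y₂‖ ≤
        (B1RG242Torus.α P 1 1 * (P.L : ℝ) ^ (1 * P.d)) * (B1.aSeq 1 P.L 1 * c₀ *
          ((⌊(((P.L : ℝ) ^ 1) - 1 + 1) / (1 : ℕ)⌋₊ + 3) ^ (0 + 1) * Real.exp (-(δ₀ * (((P.L : ℝ) ^ 1)⁻¹ * (2 * 1)))) +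
            Real.exp (-(δ₀ / 2 * (((P.L : ℝ) ^ 1)⁻¹ * 0)))) *
            Real.exp (-(δ₀ / 2 * (B5Ineq137Torus.T P (0 + 1) (fun _ => 2) y₂)))) := by
  refine ⟨(⟨1, 3, 1, 3, le_rfl, ⟨⟨1, rfl⟩, Nat.one_lt_succ_succ 1⟩⟩ : Params), rfl, rfl, sites_P3, ?_⟩
  obtain ⟨δ₀, c₀, hδ₀, hc₀, H⟩ := close235_wholeTorus_flat_cwt 0 3 ⟨⟨1, rfl⟩, by norm_num⟩ one_pos
  refine ⟨δ₀, c₀, hδ₀, hc₀, fun h y₂ => ?_⟩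
  have hv : ∀ μ : Fin ((⟨1, 3, 1, 3, le_rfl, ⟨⟨1, rfl⟩, Nat.one_lt_succ_succ 1⟩⟩ : Params)).d,
      ((fun _ => 2 : Balaban1983to89.Site (⟨1, 3, 1, 3, le_rfl, ⟨⟨1, rfl⟩, Nat.one_lt_succ_succ 1⟩⟩ : Params) (0 + 1)) μ).val = 2 := by
    intro μ
    show ZMod.val (2 : ZMod (((⟨1, 3, 1, 3, le_rfl, ⟨⟨1, rfl⟩, Nat.one_lt_succ_succ 1⟩⟩ : Params)).sitesPerDir (0 + 1))) = 2
    rw [sites_P3_1]; decide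
  refine H (⟨1, 3, 1, 3, le_rfl, ⟨⟨1, rfl⟩, Nat.one_lt_succ_succ 1⟩⟩ : Params) rfl rfl 1 le_rfl (by decide) (fun _ => 0) (fun _ => 8) (fun _ => by norm_num)
    (fun _ => by rw [sites_P3]; norm_num) (fun _ => by rw [sites_P3]; norm_num) 1 3 le_rfl 1 1 0 zero_le_one le_rfl one_pos (by norm_num)
    (fun _ => by rw [sites_P3]; norm_num) h (fun _ => 2) y₂ fun μ => ?_
  rw [hv μ]
  norm_num

/-- **THE HYPOTHESES OF `deriv231_wholeTorus_flat_cwt` ARE JOINTLY SATISFIABLE** (so the covariant-derivative analogue of (2.31) with `Ω = T_η`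
is not a statement about the empty set): THERE IS a `Setup` torus (`ℤ/162`: `d = 1`, `L = 3`, `m = 1`, `K = 3`) on which, at `k = 1`, for the
reference box `Ω₀ = [0, 24)` (`c = 0`, `M₀ = 8`), cube spacing `s = 1`, half-width `W = 4`, radii `R = 2`, `R₁ = 0`, `R₀ = 1` and the bond
`⟨10, 11⟩` (both endpoints at chart depth `≥ R₀ + R = 3` in `[0, 24)`), every displayed hypothesis holds — whence the bound there for every pure
gauge `h`, EVERY direction `μ` and every source `f` with `‖f‖_∞ ≤ F` (support distance `D = 0`). [cite: BalabanImbrieJaffe1988, (2.31) p.263] -/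
theorem deriv231_wholeTorus_flat_cwt_instance :
    ∃ (P : Params) (hPd : P.d = 0 + 1), P.L = 3 ∧ P.sitesPerDir 0 = 162 ∧
    ∃ δ₀ c₀ : ℝ, 0 < δ₀ ∧ 0 < c₀ ∧ ∀ (h : GaugeTransf P 0 U1) (μ : Fin P.d) (f : Balaban1983to89.Site P 0 → ℂ) (F : ℝ),
      (∀ y, ‖f y‖ ≤ F) →
      ‖covD P.eps⁻¹ (cfg (gaugeAct h (1 : GaugeField P 0 U1)))
            (gLocT (B1RG242Torus.α P 1 1 * (P.L : ℝ) ^ (1 * P.d)) P.eps⁻¹ (gaugeAct h (1 : GaugeField P 0 U1)) 1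
              (cubeFam hPd (P.L ^ 1) (fun _ => 0) (fun _ => 8) 1 4) (lamFam hPd (P.L ^ 1) (fun _ => 0) (fun _ => 8) 1)
              (cutoff 0 1 (B5Ineq137Torus.T P 0)) *ᵥ f) ⟨fun _ => 10, μ⟩ -
          covD P.eps⁻¹ (cfg (gaugeAct h (1 : GaugeField P 0 U1)))
            (gBox (B1RG242Torus.α P 1 1 * (P.L : ℝ) ^ (1 * P.d)) P.eps⁻¹ (gaugeAct h (1 : GaugeField P 0 U1)) 1 univ *ᵥ f) ⟨fun _ => 10, μ⟩‖ ≤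
        P.spacing 1 * (c₀ * ((⌊(((P.L : ℝ) ^ 1) - 1 + 1) / (1 : ℕ)⌋₊ + 3) ^ (0 + 1) * (1 + (P.L : ℝ) ^ 1 * ((1 - 0 : ℝ)⁻¹ + ((1 : ℕ) : ℝ)⁻¹)) *
            Real.exp (-(δ₀ * (((P.L : ℝ) ^ 1)⁻¹ * (2 * 2 - 1)))) +
          (1 + (P.L : ℝ) ^ 1 * (1 - 0 : ℝ)⁻¹) * Real.exp (-(δ₀ / 2 * (((P.L : ℝ) ^ 1)⁻¹ * (0 - 1))))) *
          Real.exp (-(δ₀ / 2 * (((P.L : ℝ) ^ 1)⁻¹ * 0))) * F) := by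
  refine ⟨(⟨1, 3, 1, 3, le_rfl, ⟨⟨1, rfl⟩, Nat.one_lt_succ_succ 1⟩⟩ : Params), rfl, rfl, sites_P3, ?_⟩
  obtain ⟨δ₀, c₀, hδ₀, hc₀, H⟩ := deriv231_wholeTorus_flat_cwt 0 3 ⟨⟨1, rfl⟩, by norm_num⟩ one_pos
  refine ⟨δ₀, c₀, hδ₀, hc₀, fun h μ f F hF => ?_⟩
  set x : Balaban1983to89.Site (⟨1, 3, 1, 3, le_rfl, ⟨⟨1, rfl⟩, Nat.one_lt_succ_succ 1⟩⟩ : Params) 0 := fun _ => 10 with hxdef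
  have hfit : ∀ i : Fin (0 + 1), (fun _ => 0 : Fin (0 + 1) → ℕ) i * ((⟨1, 3, 1, 3, le_rfl, ⟨⟨1, rfl⟩, Nat.one_lt_succ_succ 1⟩⟩ : Params)).L ^ 1 +
      ((⟨1, 3, 1, 3, le_rfl, ⟨⟨1, rfl⟩, Nat.one_lt_succ_succ 1⟩⟩ : Params)).L ^ 1 * (fun _ => 8 : Fin (0 + 1) → ℕ) i ≤
      ((⟨1, 3, 1, 3, le_rfl, ⟨⟨1, rfl⟩, Nat.one_lt_succ_succ 1⟩⟩ : Params)).sitesPerDir 0 :=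
    fun _ => by rw [sites_P3]; norm_num
  have hxv : ∀ ν : Fin ((⟨1, 3, 1, 3, le_rfl, ⟨⟨1, rfl⟩, Nat.one_lt_succ_succ 1⟩⟩ : Params)).d, (x ν).val = 10 := by
    intro ν
    show ZMod.val (10 : ZMod (((⟨1, 3, 1, 3, le_rfl, ⟨⟨1, rfl⟩, Nat.one_lt_succ_succ 1⟩⟩ : Params)).sitesPerDir 0)) = 10
    rw [sites_P3]; decide
  have hxsv : ∀ ν : Fin ((⟨1, 3, 1, 3, le_rfl, ⟨⟨1, rfl⟩, Nat.one_lt_succ_succ 1⟩⟩ : Params)).d, ((x.shift μ) ν).val = 11 := by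
    intro ν
    have hνμ : ν = μ := Subsingleton.elim _ _
    subst hνμ
    have e : (x.shift ν) ν = 10 + 1 := by
      simp only [Balaban1983to89.Site.shift, Function.update_self, hxdef]
    rw [e]
    show ZMod.val ((10 : ZMod (((⟨1, 3, 1, 3, le_rfl, ⟨⟨1, rfl⟩, Nat.one_lt_succ_succ 1⟩⟩ : Params)).sitesPerDir 0)) + 1) = 11
    rw [sites_P3]; decide
  have hx : x ∈ cubeT (d := 0) rfl (((⟨1, 3, 1, 3, le_rfl, ⟨⟨1, rfl⟩, Nat.one_lt_succ_succ 1⟩⟩ : Params)).L ^ 1) (fun _ => 0)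
      (fun i => ((⟨1, 3, 1, 3, le_rfl, ⟨⟨1, rfl⟩, Nat.one_lt_succ_succ 1⟩⟩ : Params)).L ^ 1 * (fun _ => 8 : Fin (0 + 1) → ℕ) i) := by
    rw [mem_cubeT_iff_val rfl hfit]
    intro ν; rw [hxv ν]; norm_num
  have hxe : x.shift μ ∈ cubeT (d := 0) rfl (((⟨1, 3, 1, 3, le_rfl, ⟨⟨1, rfl⟩, Nat.one_lt_succ_succ 1⟩⟩ : Params)).L ^ 1) (fun _ => 0)
      (fun i => ((⟨1, 3, 1, 3, le_rfl, ⟨⟨1, rfl⟩, Nat.one_lt_succ_succ 1⟩⟩ : Params)).L ^ 1 * (fun _ => 8 : Fin (0 + 1) → ℕ) i) := by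
    rw [mem_cubeT_iff_val rfl hfit]
    intro ν; rw [hxsv ν]; norm_num
  have hbx : ∀ i : Fin (0 + 1),
      boxCoord (d := 0) rfl (((⟨1, 3, 1, 3, le_rfl, ⟨⟨1, rfl⟩, Nat.one_lt_succ_succ 1⟩⟩ : Params)).L ^ 1) (fun _ => 0) x i = 10 := by
    intro i; simp only [boxCoord, hxv]; norm_num
  have hbxe : ∀ i : Fin (0 + 1),
      boxCoord (d := 0) rfl (((⟨1, 3, 1, 3, le_rfl, ⟨⟨1, rfl⟩, Nat.one_lt_succ_succ 1⟩⟩ : Params)).L ^ 1) (fun _ => 0) (x.shift μ) i = 11 := by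
    intro i; simp only [boxCoord, hxsv]; norm_num
  exact H (⟨1, 3, 1, 3, le_rfl, ⟨⟨1, rfl⟩, Nat.one_lt_succ_succ 1⟩⟩ : Params) rfl rfl 1 le_rfl (by decide) (fun _ => 0) (fun _ => 8) (fun _ => by norm_num) hfit
    (fun _ => by rw [sites_P3]; norm_num) 1 4 le_rfl 2 1 0 (by norm_num) le_rfl one_pos (by norm_num) (fun _ => by rw [sites_P3]; norm_num) h
    x μ hx (fun i => by rw [hbx i]; norm_num) hxe (fun i => by rw [hbxe i]; norm_num) f F 0 hF le_rfl
    (fun y _ => B5Ineq137Torus.T_nonneg (⟨1, 3, 1, 3, le_rfl, ⟨⟨1, rfl⟩, Nat.one_lt_succ_succ 1⟩⟩ : Params) 0 x y)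

end Instance

end

end Literature.MathematicalPhysics.QuantumFieldTheory.BalabanImbrieJaffe1984to88.BIJ88Close231WholeTorusFlatCwt
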